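import Literature.AlgebraicGeometry.Motives.HodgeThetaSubalgebraUnitaryThreeCoprimeCore
import HarnessLib

/-!
# The raising-rank lemma for Hermitian `Θ`-graded matrix Lie algebras: a raising operator of maximal rank
# `r < dim P` forces the Levi line algebra of type `(r | dim Q − r)` to be deficient
# (the «Φ-route»; input of Ribet 1983 Thm. 3 at multiplicities `(4, b)` and beyond)

Family `hodge`, layer `Literature/AlgebraicGeometry/Motives` (pure linear algebra over `ℂ`; no geometry). Research
context: cell `pub-hodge-ring2` (HONEST FRAMING: research route conditional on HC_CM; not a corollary; Q11.4-sentence-2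
already refuted in dim ≥ 3), Literature lane gen 83, programme R64 (the first brick of the `(4, b)` unitary core).
UNCONDITIONAL; theorems only, no definition, no named fact (D-0026), no `sorry`.

THE SETTING is that of the tree's classification-free unitary cores (`HodgeThetaSubalgebraUnitaryTwoOddCore`,
`…ThreeCoprimeCore`): `𝔊 ⊆ End_ℂ(W)` bracket-closed and irreducible, an involution `Θ ∈ 𝔊` with eigenspaces
`P = {Θ = 1}`, `Q = {Θ = −1}`, a Hermitian pairing `s` with `P ⊥ Q`, definite on `P` and on `Q`, for which `𝔊` is
adjoint-closed (Deligne: `ad C` is a Cartan involution of `Hg`, LNM 900 I Prop. 3.6; the Hodge–Riemann form).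

THE THEOREM (`UnitaryRaisingRank.exists_raise_rank_gt`). Let `B ∈ 𝔊` be raising (`ΘB = B = −BΘ`) of rank `r ≥ 1` with
`r < dim P` and `2r ≤ dim Q`, and suppose the abstract core of type `(r | dim Q − r)` holds (hypothesis-schema `hcore`,
literally the `hcore` of `UnitaryThreeCoprime.levi_instance`: every bracket-closed irreducible adjoint-closed Hermitian
`Θ`-graded line algebra with pieces of dimensions `r` and `dim Q − r` is everything — supplied in applications by
`UnitaryTwoOdd.eq_top` (`r = 2`, `dim Q` odd) or `UnitaryThreeCoprime.eq_top` (`r = 3`, `3 ∤ dim Q − 3`)). Then some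
raising operator in `𝔊` has rank `> r`. PROOF (new; much shorter than the rank-three lemma of `…ThreeCoprimeCore` §4,
which it does NOT supersede — there `dim Q − r < r` is allowed): suppose `r` is maximal. Let `C = B†`, `D ∈ 𝔊` the
projector pair (`D = 1` on `P₁ = B(W)`, `0` on `P₀ = P ∩ ker C`, `−1` on `Q₁ = C(P)`, `0` on `Q₀ = Q ∩ ker B`).
(★) every raising `B'` maps `Q₀` into `P₁` (else `B + ½([D,[D,B']] − 3[D,B'] + 2B')` has rank `r + 1`);
(♣) `B'(C B''q) + B''(C B'q) ∈ P₁` for raising `B', B''`, `q ∈ Q₀`. The involution `Θ₁ := Θ − 2D ∈ 𝔊` is self-adjoint,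
commutes with `Θ`, and `{Θ₁ = −1} = P₁ ⊕ Q₀`; by `levi_instance` and `hcore` every endomorphism of `P₁ ⊕ Q₀` is induced
by some `Z ∈ 𝔊` commuting with `Θ₁`, whose raising part `B_Z` then restricts on `Q₀` to any prescribed `T : Q₀ → P₁`.
For `T` SURJECTIVE (possible as `dim Q₀ ≥ r`), `B_Z(W) ⊇ P₁` has rank `≤ r`, so `B_Z(W) = P₁`. For an arbitrary raising
`B'`, `T' := B'|_{Q₀}` and a scalar `c` with `T' + cT₀` surjective (all but the eigenvalues of `−T'R`, `R` a section of
`T₀`; `ℂ` is infinite), the operator `B' + cB_{T₀} − B_{T'+cT₀}` kills `Q₀`, hence by (♣) maps `Q₁ = C(P₁)` into `P₁`;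
so `B'(Q) ⊆ P₁`. Finally a non-zero `η ∈ P₀` (exists as `r < dim P`) is `s`-orthogonal to `P₁ = B(W)` (`s(Bw, η) =
s(w, Cη) = 0`), so for every LOWERING `C' ∈ 𝔊` with raising adjoint `Y`: `s(C'η, C'η) = s(η, Y C'η) = 0`, `C'η = 0` —
`η` is killed by all lowering operators, contradicting irreducibility (`UnitaryThetaCore.eq_zero_of_forall_raise_apply_eq_zero`
for `−Θ`).

* §1 `UnitaryRaisingRank.exists_surjective_add_smul` — `T₀` surjective ⟹ `T + c T₀` surjective for some `c ∈ ℂ`.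
* §2 **`UnitaryRaisingRank.exists_raise_rank_gt`** — the raising-rank lemma.
* §3 **`UnitaryRaisingRank.exists_raise_rank_gt_of_two_le`** — the sharp form: `dim Q ≥ r + 2` instead of `2r`
  (rank-one realisations and the relation (♣) only; lit gen 83, same session).

## References
* [Ribet1983] K. A. Ribet, *Hodge classes on certain types of abelian varieties*, Amer. J. Math. 105 (1983), Thm. 3
  (= [Gordon1997, Thm. 6.3 (3)], held `paper:arxiv-alg-geom_9709030` pp. 18–19: «it is here that the relative primality
  of n′ and n″ is required»).
* [Deligne1982HodgeCycles] P. Deligne, *Hodge cycles on abelian varieties*, LNM 900 (1982), I §3 Prop. 3.4, 3.6.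
* [GoodmanWallachGTM255] R. Goodman, N. R. Wallach, GTM 255 (2009), §4.1.1 (graded components), §3.3.2.
* [HoffmanKunze1971LinearAlgebra] K. Hoffman, R. Kunze, *Linear Algebra* (1971), §6.2 (finitely many characteristic values).
-/

noncomputable section

namespace Literature.AlgebraicGeometry.Motives

namespace HodgeStructure

universe u

variable {W : Type u} [AddCommGroup W] [Module ℂ W]

/-! ### §1 Surjectivity is generic along a pencil through a surjective map -/

/-- **`T + c·T₀` is surjective for some scalar `c`, when `T₀` is.** With `R` a linear section of `T₀`, `(T + cT₀)R =
TR + c` is invertible as soon as `−c`… precisely as soon as `c` is not an eigenvalue of `−TR`; a linear operator on a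
finite-dimensional space has finitely many eigenvalues and `ℂ` is infinite.
[cite: HoffmanKunze1971LinearAlgebra, §6.2] -/
theorem UnitaryRaisingRank.exists_surjective_add_smul {E F : Type*} [AddCommGroup E] [Module ℂ E] [AddCommGroup F]
    [Module ℂ F] [FiniteDimensional ℂ F] (T₀ T : E →ₗ[ℂ] F) (h₀ : Function.Surjective T₀) :
    ∃ c : ℂ, Function.Surjective (T + c • T₀) := by
  classical
  set b := Module.finBasis ℂ F with hbdef
  have hpre : ∀ i, ∃ e, T₀ e = b i := fun i => h₀ (b i)
  choose g hg using hpre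
  set R : F →ₗ[ℂ] E := b.constr ℂ g with hRdef
  have hR : ∀ i, T₀ (R (b i)) = b i := fun i => by rw [hRdef, Module.Basis.constr_basis, hg]
  have hT₀R : T₀ ∘ₗ R = LinearMap.id := b.ext fun i => by rw [LinearMap.comp_apply, hR, LinearMap.id_apply]
  set Fm : Module.End ℂ F := T ∘ₗ R with hFmdef
  obtain ⟨c, hc⟩ := Infinite.exists_notMem_finset (-Fm).finite_hasEigenvalue.toFinset
  have hc' : ¬ (-Fm).HasEigenvalue c := fun h => hc ((Set.Finite.mem_toFinset _).2 h)
  have hunit : IsUnit (algebraMap ℂ (Module.End ℂ F) c - (-Fm)) := by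
    by_contra h
    exact hc' (Module.End.hasEigenvalue_iff_mem_spectrum.2 h)
  have heq : algebraMap ℂ (Module.End ℂ F) c - (-Fm) = (T + c • T₀) ∘ₗ R := by
    rw [Algebra.algebraMap_eq_smul_one, sub_neg_eq_add, LinearMap.add_comp, LinearMap.smul_comp, hT₀R, add_comm]
    rfl
  have hrange : LinearMap.range ((T + c • T₀) ∘ₗ R) = ⊤ := by
    rw [← heq]; exact (LinearMap.isUnit_iff_range_eq_top _).1 hunit
  refine ⟨c, fun y => ?_⟩
  have hy : y ∈ LinearMap.range ((T + c • T₀) ∘ₗ R) := hrange ▸ Submodule.mem_top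
  obtain ⟨x, hx⟩ := hy
  exact ⟨R x, hx⟩

/-! ### §2 The raising-rank lemma -/

/-- **The raising-rank lemma (Φ-route).** In the Hermitian `Θ`-graded setting of the unitary cores, let `B ∈ 𝔊` be
raising of rank `r` with `0 < r < dim P` and `2r ≤ dim Q`, and assume the abstract core of type `(r | dim Q − r)`
(hypothesis-schema `hcore`, as in `UnitaryThreeCoprime.levi_instance`). Then `𝔊` contains a raising operator of rank
`> r`. See the module docstring for the proof. [cite: Ribet1983, Thm. 3] [cite: Deligne1982HodgeCycles, I §3 Prop. 3.6]
[cite: GoodmanWallachGTM255, §4.1.1] -/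
theorem UnitaryRaisingRank.exists_raise_rank_gt [FiniteDimensional ℂ W] {𝔊 : Submodule ℂ (Module.End ℂ W)}
    (hbr : ∀ Y ∈ 𝔊, ∀ Z ∈ 𝔊, Y * Z - Z * Y ∈ 𝔊)
    (hirr : ∀ U : Submodule ℂ W, (∀ A ∈ 𝔊, ∀ u ∈ U, A u ∈ U) → U = ⊥ ∨ U = ⊤)
    {Θ : Module.End ℂ W} (hΘ : Θ ∈ 𝔊) (hΘΘ : Θ * Θ = 1)
    {P Q : Submodule ℂ W} (hP : ∀ x, x ∈ P ↔ Θ x = x) (hQ : ∀ x, x ∈ Q ↔ Θ x = -x)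
    {s : W → W → ℂ} (hadd : ∀ x y z, s (x + y) z = s x z + s y z) (hsymm : ∀ x y, s y x = starRingEnd ℂ (s x y))
    (hPQ : ∀ p ∈ P, ∀ q ∈ Q, s p q = 0) (hdefP : ∀ p ∈ P, s p p = 0 → p = 0) (hdefQ : ∀ q ∈ Q, s q q = 0 → q = 0)
    (hadj : ∀ X ∈ 𝔊, ∃ Y ∈ 𝔊, ∀ x y, s (X x) y = s x (Y y))
    {B : Module.End ℂ W} (hB : B ∈ 𝔊) (hΘB : Θ * B = B) (hBΘ : B * Θ = -B)
    (hr0 : 0 < Module.finrank ℂ (LinearMap.range B))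
    (hrP : Module.finrank ℂ (LinearMap.range B) < Module.finrank ℂ P)
    (hrQ : Module.finrank ℂ (LinearMap.range B) + Module.finrank ℂ (LinearMap.range B) ≤ Module.finrank ℂ Q)
    (hcore : ∀ (U : Submodule ℂ W) (𝔩 : Submodule ℂ (Module.End ℂ U)) (ι : Module.End ℂ U) (P' Q' : Submodule ℂ U),
      (∀ A ∈ 𝔩, ∀ A' ∈ 𝔩, A * A' - A' * A ∈ 𝔩) →
      (∀ V : Submodule ℂ U, (∀ A ∈ 𝔩, ∀ u ∈ V, A u ∈ V) → V = ⊥ ∨ V = ⊤) →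
      ι ∈ 𝔩 → ι * ι = 1 → (∀ x, x ∈ P' ↔ ι x = x) → (∀ x, x ∈ Q' ↔ ι x = -x) →
      Module.finrank ℂ P' = Module.finrank ℂ (LinearMap.range B) →
      Module.finrank ℂ Q' + Module.finrank ℂ (LinearMap.range B) = Module.finrank ℂ Q →
      (∀ p ∈ P', ∀ q ∈ Q', s (p : W) q = 0) → (∀ p ∈ P', s (p : W) p = 0 → p = 0) →
      (∀ q ∈ Q', s (q : W) q = 0 → q = 0) →
      (∀ A ∈ 𝔩, ∃ A' ∈ 𝔩, ∀ x y : U, s ((A x : U) : W) y = s x ((A' y : U) : W)) → 𝔩 = ⊤) :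
    ∃ B' ∈ 𝔊, Θ * B' = B' ∧ B' * Θ = -B' ∧
      Module.finrank ℂ (LinearMap.range B) < Module.finrank ℂ (LinearMap.range B') := by
  classical
  obtain ⟨haddr, h0r, h0l, hnegr, hnegl, hsubr, hsubl⟩ := UnitaryTwoOdd.herm_right hadd hsymm
  have hΘΘv : ∀ v, Θ (Θ v) = v := fun v => by rw [← Module.End.mul_apply, hΘΘ, Module.End.one_apply]
  have hPhat : ∀ w, (2 : ℂ)⁻¹ • (w + Θ w) ∈ P := fun w => (hP _).2 (by rw [map_smul, map_add, hΘΘv, add_comm])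
  have hQhat : ∀ w, (2 : ℂ)⁻¹ • (w - Θ w) ∈ Q := fun w =>
    (hQ _).2 (by rw [map_smul, map_sub, hΘΘv, ← smul_neg, neg_sub])
  have hsplit : ∀ w, (2 : ℂ)⁻¹ • (w + Θ w) + (2 : ℂ)⁻¹ • (w - Θ w) = w := fun w => by module
  have hraiseval : ∀ Z : Module.End ℂ W, Θ * Z = Z → ∀ w, Z w ∈ P := fun Z hΘZ w =>
    (hP _).2 (by rw [← Module.End.mul_apply, hΘZ])
  have hraiseP : ∀ Z : Module.End ℂ W, Z * Θ = -Z → ∀ p ∈ P, Z p = 0 := fun Z hZΘ p hp => by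
    have h : Z p = -(Z p) := by
      conv_lhs => rw [← (hP p).1 hp]
      rw [← Module.End.mul_apply, hZΘ, LinearMap.neg_apply]
    have h2 : (2 : ℂ) • Z p = 0 := by rw [two_smul]; nth_rewrite 2 [h]; rw [add_neg_cancel]
    exact (smul_eq_zero.1 h2).resolve_left two_ne_zero
  have hΘs := UnitaryTwoOdd.theta_selfAdjoint hadd hsymm hΘΘ hP hQ hPQ
  by_contra hcon
  push Not at hcon
  have hmax : ∀ B' ∈ 𝔊, Θ * B' = B' → B' * Θ = -B' →
      Module.finrank ℂ (LinearMap.range B') ≤ Module.finrank ℂ (LinearMap.range B) := hcon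
  -- STEP 1: `B`, its adjoint `C` and the projector pair `D`
  have hBmem : ∀ w, B w ∈ P := hraiseval B hΘB
  have hBP : ∀ p ∈ P, B p = 0 := hraiseP B hBΘ
  have hrangeP : LinearMap.range B ≤ P := by rintro _ ⟨w, rfl⟩; exact hBmem w
  obtain ⟨C, hC, hBC⟩ := hadj B hB
  obtain ⟨hΘC, hCΘ⟩ := UnitaryTwoOdd.lower_of_adjoint hadd hsymm hΘΘ hP hQ hPQ hdefP hdefQ hΘB hBΘ hBC
  have hCmem : ∀ w, C w ∈ Q := fun w => (hQ _).2 (by rw [← Module.End.mul_apply, hΘC, LinearMap.neg_apply])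
  have hCQ : ∀ q ∈ Q, C q = 0 := fun q hq => by
    have h : C q = -(C q) := by
      conv_lhs => rw [← neg_neg q, ← (hQ q).1 hq, map_neg, ← Module.End.mul_apply, hCΘ]
    have h2 : (2 : ℂ) • C q = 0 := by rw [two_smul]; nth_rewrite 2 [h]; rw [add_neg_cancel]
    exact (smul_eq_zero.1 h2).resolve_left two_ne_zero
  obtain ⟨D, hD, hDΘ, hD1, hD2, hD3, hD4, hD5, hD6, hpos1, hpos2, hdec, hDs⟩ :=
    UnitaryThreeCoprime.exists_projector_pair hbr hΘΘ hP hQ hadd hsymm hPQ hdefP hdefQ hB hC hΘB hBΘ hBC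
  have hDP : ∀ p ∈ P, D p ∈ P := fun p hp => hrangeP (hD5 p hp).1
  have hDfix : ∀ x ∈ LinearMap.range B, D x = x := by rintro _ ⟨w, rfl⟩; exact hD1 w
  have hDDP : ∀ p ∈ P, D (D p) = D p := fun p hp => hDfix _ (hD5 p hp).1
  have hkerD : ∀ p ∈ P, D p = 0 → C p = 0 := fun p hp h => by
    have h' := (hD5 p hp).2; rwa [h, sub_zero] at h'
  have hCinjR : ∀ x ∈ LinearMap.range B, C x = 0 → x = 0 := by rintro _ ⟨w, rfl⟩ h; exact hpos2 w h
  have hCD : ∀ p ∈ P, C p = C (D p) := fun p hp => by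
    have h := (hD5 p hp).2; rw [map_sub, sub_eq_zero] at h; exact h
  -- STEP 2 (★): every raising operator maps `Q₀ = Q ∩ ker B` into `P₁ = B(W)`
  have hcommbr : ∀ X : Module.End ℂ W, Θ * X = X → X * Θ = -X →
      Θ * (D * X - X * D) = D * X - X * D ∧ (D * X - X * D) * Θ = -(D * X - X * D) := fun X h1 h2 =>
    ⟨by rw [mul_sub, ← mul_assoc, ← hDΘ, mul_assoc, h1, ← mul_assoc, h1],
     by rw [sub_mul, mul_assoc, h2, mul_assoc, hDΘ, ← mul_assoc, h2, mul_neg, neg_mul, neg_sub_neg, neg_sub]⟩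
  have hstar : ∀ B' ∈ 𝔊, Θ * B' = B' → B' * Θ = -B' → ∀ q ∈ Q, B q = 0 → D (B' q) = B' q := by
    intro B' hB' hΘB' hB'Θ
    by_contra hne
    push Not at hne
    obtain ⟨q₀, hq₀Q, hBq₀, hneq⟩ := hne
    have hB'P : ∀ p ∈ P, B' p = 0 := hraiseP B' hB'Θ
    have hB'mem : ∀ w, B' w ∈ P := hraiseval B' hΘB'
    set N : Module.End ℂ W := D * B' - B' * D with hNdef
    obtain ⟨hΘN, hNΘ⟩ : Θ * N = N ∧ N * Θ = -N := hcommbr B' hΘB' hB'Θ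
    set N₂ : Module.End ℂ W := D * N - N * D with hN₂def
    obtain ⟨hΘN₂, hN₂Θ⟩ : Θ * N₂ = N₂ ∧ N₂ * Θ = -N₂ := hcommbr N hΘN hNΘ
    have hNmem : N ∈ 𝔊 := hbr D hD B' hB'
    have hN₂mem : N₂ ∈ 𝔊 := hbr D hD N hNmem
    set B₀ : Module.End ℂ W := (2 : ℂ)⁻¹ • (N₂ - (3 : ℂ) • N + (2 : ℂ) • B') with hB₀def
    have hB₀mem : B₀ ∈ 𝔊 := Submodule.smul_mem _ _ (Submodule.add_mem _ (Submodule.sub_mem _ hN₂mem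
      (Submodule.smul_mem _ _ hNmem)) (Submodule.smul_mem _ _ hB'))
    have hΘB₀ : Θ * B₀ = B₀ := by
      rw [hB₀def, mul_smul_comm, mul_add, mul_sub, mul_smul_comm, mul_smul_comm, hΘN₂, hΘN, hΘB']
    have hB₀Θ : B₀ * Θ = -B₀ := by
      rw [hB₀def, smul_mul_assoc, add_mul, sub_mul, smul_mul_assoc, smul_mul_assoc, hN₂Θ, hNΘ, hB'Θ]
      module
    -- values of `N`, `N₂`, `B₀`
    have hNq : ∀ q ∈ Q, B q = 0 → N q = D (B' q) := fun q hq hBq => by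
      rw [hNdef, LinearMap.sub_apply, Module.End.mul_apply, Module.End.mul_apply, hD4 q hq hBq, map_zero, sub_zero]
    have hNP : ∀ p ∈ P, N p = 0 := fun p hp => by
      rw [hNdef, LinearMap.sub_apply, Module.End.mul_apply, Module.End.mul_apply, hB'P p hp, map_zero,
        hB'P _ (hDP p hp), sub_zero]
    have hNC : ∀ p ∈ P, N (C p) = D (B' (C p)) + B' (C p) := fun p hp => by
      rw [hNdef, LinearMap.sub_apply, Module.End.mul_apply, Module.End.mul_apply, hD3 p hp, map_neg, sub_neg_eq_add]
    have hN₂q : ∀ q ∈ Q, B q = 0 → N₂ q = D (B' q) := fun q hq hBq => by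
      rw [hN₂def, LinearMap.sub_apply, Module.End.mul_apply, Module.End.mul_apply, hNq q hq hBq, hD4 q hq hBq,
        map_zero, sub_zero, hDDP _ (hB'mem q)]
    have hN₂C : ∀ p ∈ P, N₂ (C p) = D (B' (C p)) + D (B' (C p)) + (D (B' (C p)) + B' (C p)) := fun p hp => by
      rw [hN₂def, LinearMap.sub_apply, Module.End.mul_apply, Module.End.mul_apply, hNC p hp, hD3 p hp, map_neg,
        hNC p hp, map_add, hDDP _ (hB'mem _), sub_neg_eq_add]
    have hB₀q : ∀ q ∈ Q, B q = 0 → B₀ q = B' q - D (B' q) := fun q hq hBq => by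
      rw [hB₀def, LinearMap.smul_apply, LinearMap.add_apply, LinearMap.sub_apply, LinearMap.smul_apply,
        LinearMap.smul_apply, hN₂q q hq hBq, hNq q hq hBq]
      module
    have hB₀C : ∀ p ∈ P, B₀ (C p) = 0 := fun p hp => by
      rw [hB₀def, LinearMap.smul_apply, LinearMap.add_apply, LinearMap.sub_apply, LinearMap.smul_apply,
        LinearMap.smul_apply, hN₂C p hp, hNC p hp]
      module
    -- `B + B₀` is raising and maps onto `P`
    have hsum_mem : B + B₀ ∈ 𝔊 := Submodule.add_mem _ hB hB₀mem
    have hΘsum : Θ * (B + B₀) = B + B₀ := by rw [mul_add, hΘB, hΘB₀]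
    have hsumΘ : (B + B₀) * Θ = -(B + B₀) := by rw [add_mul, hBΘ, hB₀Θ, neg_add]
    set x₀ := B' q₀ - D (B' q₀) with hx₀def
    have hx₀P : x₀ ∈ P := Submodule.sub_mem _ (hB'mem q₀) (hDP _ (hB'mem q₀))
    have hx₀0 : x₀ ≠ 0 := fun h => hneq (by rw [hx₀def, sub_eq_zero] at h; exact h.symm)
    have hx₀nr : x₀ ∉ LinearMap.range B := fun h => by
      have h1 := hDfix x₀ h
      rw [hx₀def, map_sub, hDDP _ (hB'mem q₀), sub_self] at h1
      exact hx₀0 h1.symm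
    have hx₀val : (B + B₀) q₀ = x₀ := by
      rw [LinearMap.add_apply, hBq₀, zero_add, hB₀q q₀ hq₀Q hBq₀]
    have hrange1 : LinearMap.range B ≤ LinearMap.range (B + B₀) := by
      rintro _ ⟨w, rfl⟩
      set q := (2 : ℂ)⁻¹ • (w - Θ w) with hqdef
      obtain ⟨hDq, hBq⟩ := hD6 q (hQhat w)
      obtain ⟨p', hp', hp'q⟩ := hDq
      refine ⟨-(D q), ?_⟩
      have hBw : B w = B q := by
        conv_lhs => rw [← hsplit w, map_add, hBP _ (hPhat w), zero_add]
      rw [LinearMap.add_apply, map_neg, map_neg, ← hp'q, hB₀C p' hp', neg_zero, add_zero, hp'q, hBw]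
      rw [map_add] at hBq
      rw [← neg_eq_of_add_eq_zero_right hBq, neg_neg]
    have hrange2 : LinearMap.range B ⊔ (ℂ ∙ x₀) ≤ LinearMap.range (B + B₀) :=
      sup_le hrange1 ((Submodule.span_singleton_le_iff_mem _ _).2 ⟨q₀, hx₀val⟩)
    have hinf : LinearMap.range B ⊓ (ℂ ∙ x₀) = ⊥ := by
      rw [eq_bot_iff]
      rintro y ⟨hy1, hy2⟩
      rw [Submodule.mem_bot]
      obtain ⟨c, rfl⟩ := Submodule.mem_span_singleton.1 hy2
      by_cases hc : c = 0
      · rw [hc, zero_smul]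
      · exact absurd (by
          have := Submodule.smul_mem _ c⁻¹ hy1
          rwa [smul_smul, inv_mul_cancel₀ hc, one_smul] at this) hx₀nr
    have hfin : Module.finrank ℂ ↥(LinearMap.range B ⊔ (ℂ ∙ x₀)) = Module.finrank ℂ (LinearMap.range B) + 1 := by
      have h := Submodule.finrank_sup_add_finrank_inf_eq (LinearMap.range B) (ℂ ∙ x₀)
      rw [hinf, finrank_bot, add_zero, finrank_span_singleton hx₀0] at h
      exact h
    have hmono := Submodule.finrank_mono hrange2
    have hle' := hmax (B + B₀) hsum_mem hΘsum hsumΘ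
    rw [hfin] at hmono
    omega
  have hstar' : ∀ B' ∈ 𝔊, Θ * B' = B' → B' * Θ = -B' → ∀ q ∈ Q, B q = 0 → B' q ∈ LinearMap.range B :=
    fun B' hB' h1 h2 q hq hBq => hstar B' hB' h1 h2 q hq hBq ▸ (hD5 _ (hraiseval B' h1 q)).1
  -- STEP 3 (♣)
  have hclub : ∀ B' ∈ 𝔊, Θ * B' = B' → B' * Θ = -B' → ∀ B'' ∈ 𝔊, Θ * B'' = B'' → B'' * Θ = -B'' →
      ∀ q ∈ Q, B q = 0 → D (B' (C (B'' q)) + B'' (C (B' q))) = B' (C (B'' q)) + B'' (C (B' q)) := by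
    intro B' hB' hΘB' hB'Θ B'' hB'' hΘB'' hB''Θ q hq hBq
    set M : Module.End ℂ W := B' * C - C * B' with hMdef
    have hMmem : M ∈ 𝔊 := hbr B' hB' C hC
    have hMΘ : M * Θ = Θ * M := by
      rw [hMdef, sub_mul, mul_sub, mul_assoc, hCΘ, mul_assoc, hB'Θ, ← mul_assoc, hΘB', ← mul_assoc, hΘC, mul_neg,
        neg_mul]
    set R : Module.End ℂ W := M * B'' - B'' * M with hRdef
    have hRmem : R ∈ 𝔊 := hbr M hMmem B'' hB''
    have hΘR : Θ * R = R := by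
      rw [hRdef, mul_sub, ← mul_assoc, ← hMΘ, mul_assoc, hΘB'', ← mul_assoc, hΘB'']
    have hRΘ : R * Θ = -R := by
      rw [hRdef, sub_mul, mul_assoc, hB''Θ, mul_assoc, hMΘ, ← mul_assoc, hB''Θ, mul_neg, neg_mul, neg_sub_neg, neg_sub]
    have h := hstar R hRmem hΘR hRΘ q hq hBq
    have hRq : R q = B' (C (B'' q)) + B'' (C (B' q)) := by
      rw [hRdef, LinearMap.sub_apply, Module.End.mul_apply, Module.End.mul_apply, hMdef, LinearMap.sub_apply,
        LinearMap.sub_apply, Module.End.mul_apply, Module.End.mul_apply, Module.End.mul_apply, Module.End.mul_apply,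
        hraiseP B' hB'Θ _ (hraiseval B'' hΘB'' q), map_zero, sub_zero, hCQ q hq, map_zero, zero_sub, map_neg,
        sub_neg_eq_add]
    rwa [hRq] at h
  -- STEP 4: dimensions of the pieces `P₀ = P ∩ ker C`, `Q₁ = C(P)`, `Q₀ = Q ∩ ker B`
  have hfinP₀ : Module.finrank ℂ ↥(P ⊓ LinearMap.ker C) + Module.finrank ℂ (LinearMap.range B) =
      Module.finrank ℂ P := by
    have hsup : (P ⊓ LinearMap.ker C) ⊔ LinearMap.range B = P := by
      apply le_antisymm (sup_le inf_le_left hrangeP)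
      intro p hp
      obtain ⟨hDp, hCp⟩ := hD5 p hp
      have h : p = (p - D p) + D p := by abel
      rw [h]
      exact Submodule.add_mem _ (Submodule.mem_sup_left (Submodule.mem_inf.2
        ⟨Submodule.sub_mem _ hp (hrangeP hDp), LinearMap.mem_ker.2 hCp⟩)) (Submodule.mem_sup_right hDp)
    have hinf : (P ⊓ LinearMap.ker C) ⊓ LinearMap.range B = ⊥ := by
      rw [eq_bot_iff]
      rintro x ⟨⟨-, hxC⟩, hxr⟩
      rw [Submodule.mem_bot]
      exact hCinjR x hxr (LinearMap.mem_ker.1 hxC)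
    have h := Submodule.finrank_sup_add_finrank_inf_eq (P ⊓ LinearMap.ker C) (LinearMap.range B)
    rw [hsup, hinf, finrank_bot, add_zero] at h
    exact h.symm
  obtain ⟨⟨η, hηmem⟩, hη0⟩ := Module.finrank_pos_iff_exists_ne_zero.1
    (show 0 < Module.finrank ℂ ↥(P ⊓ LinearMap.ker C) by omega)
  have hη0' : η ≠ 0 := fun h => hη0 (Subtype.ext h)
  obtain ⟨hηP, hηC⟩ := Submodule.mem_inf.1 hηmem
  have hCη : C η = 0 := LinearMap.mem_ker.1 hηC
  have hΘη : Θ η = η := (hP η).1 hηP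
  set gC : ↥(LinearMap.range B) →ₗ[ℂ] W := C ∘ₗ (LinearMap.range B).subtype with hgCdef
  have hgCapply : ∀ x : LinearMap.range B, gC x = C x := fun x => rfl
  have hgCinj : Function.Injective gC := by
    intro x y hxy
    apply Subtype.ext
    have h : C ((x : W) - y) = 0 := by rw [map_sub, sub_eq_zero]; exact hxy
    exact sub_eq_zero.1 (hCinjR _ (Submodule.sub_mem _ x.2 y.2) h)
  -- STEP 5: the involution `Θ' = 2D − Θ` and its Levi instance on `{Θ' = −1} = P₀ ⊕ Q₁`
  set Θ' : Module.End ℂ W := (2 : ℂ) • D - Θ with hΘ'def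
  have hΘ'mem : Θ' ∈ 𝔊 := Submodule.sub_mem _ (Submodule.smul_mem _ _ hD) hΘ
  have hΘ'apply : ∀ w, Θ' w = D w + D w - Θ w := fun w => by
    rw [hΘ'def, LinearMap.sub_apply, LinearMap.smul_apply, two_smul]
  have hΘ'a : ∀ a ∈ LinearMap.range B, Θ' a = a := fun a ha => by
    rw [hΘ'apply, hDfix a ha, (hP a).1 (hrangeP ha)]; abel
  have hΘ'b : ∀ b ∈ P ⊓ LinearMap.ker C, Θ' b = -b := fun b hb => by
    obtain ⟨hbP, hbC⟩ := Submodule.mem_inf.1 hb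
    rw [hΘ'apply, hD2 b hbP (LinearMap.mem_ker.1 hbC), (hP b).1 hbP]; abel
  have hΘ'c : ∀ c ∈ P.map C, Θ' c = -c := fun c hc => by
    obtain ⟨p, hp, rfl⟩ := hc
    rw [hΘ'apply, hD3 p hp, (hQ _).1 (hCmem p)]; abel
  have hΘ'd : ∀ d ∈ Q ⊓ LinearMap.ker B, Θ' d = d := fun d hd => by
    obtain ⟨hdQ, hdB⟩ := Submodule.mem_inf.1 hd
    rw [hΘ'apply, hD4 d hdQ (LinearMap.mem_ker.1 hdB), (hQ d).1 hdQ]; abel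
  have hΘ'Θ' : Θ' * Θ' = 1 := by
    refine LinearMap.ext fun w => ?_
    obtain ⟨a, ha, b, hb, c, hc, d, hd, rfl⟩ := hdec w
    have h1 : Θ' (a + b + c + d) = a - b - c + d := by
      rw [map_add, map_add, map_add, hΘ'a a ha, hΘ'b b hb, hΘ'c c hc, hΘ'd d hd]; abel
    have h2 : Θ' (a - b - c + d) = a + b + c + d := by
      rw [map_add, map_sub, map_sub, hΘ'a a ha, hΘ'b b hb, hΘ'c c hc, hΘ'd d hd]; abel
    rw [Module.End.mul_apply, Module.End.one_apply, h1, h2]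
  have h12 : Θ' * Θ = Θ * Θ' := by
    rw [hΘ'def, sub_mul, mul_sub, smul_mul_assoc, mul_smul_comm, hDΘ]
  have hΘ's : ∀ x y, s (Θ' x) y = s x (Θ' y) := fun x y => by
    rw [hΘ'apply, hΘ'apply, hsubl, hadd, hsubr, haddr, hDs, hΘs]
  -- the involution `Θ₁ := −Θ' = Θ − 2D` and `U := {Θ₁ = −1} = P₁ ⊕ Q₀`
  have hnΘ'mem : -Θ' ∈ 𝔊 := Submodule.neg_mem _ hΘ'mem
  have hnΘ'sq : (-Θ') * (-Θ') = 1 := by rw [neg_mul_neg, hΘ'Θ']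
  have hnΘ's : ∀ x y, s ((-Θ') x) y = s x ((-Θ') y) := fun x y => by
    rw [LinearMap.neg_apply, LinearMap.neg_apply, hnegl, hnegr, hΘ's]
  have hn12 : (-Θ') * Θ = Θ * (-Θ') := by rw [neg_mul, mul_neg, h12]
  set U : Submodule ℂ W := LinearMap.ker (Θ' - 1) with hUdef
  have hU' : ∀ x, x ∈ U ↔ Θ' x = x := fun x => by
    rw [hUdef, LinearMap.mem_ker, LinearMap.sub_apply, Module.End.one_apply, sub_eq_zero]
  have hU : ∀ x, x ∈ U ↔ (-Θ') x = -x := fun x => by rw [hU', LinearMap.neg_apply, neg_inj]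
  have hPUle : LinearMap.range B ≤ U := fun a ha => (hU' a).2 (hΘ'a a ha)
  have hQUle : Q ⊓ LinearMap.ker B ≤ U := fun d hd => (hU' d).2 (hΘ'd d hd)
  have hPUmem : ∀ x ∈ U, Θ x = x → x ∈ LinearMap.range B := fun x hxU hΘx => by
    have hxP : x ∈ P := (hP x).2 hΘx
    have h := (hU' x).1 hxU
    rw [hΘ'apply, hΘx, sub_eq_iff_eq_add, ← two_smul ℂ, ← two_smul ℂ] at h
    have hDx : D x = x := smul_right_injective W (two_ne_zero' ℂ) h
    rw [← hDx]
    exact (hD5 x hxP).1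
  have hPUΘ : ∀ x ∈ LinearMap.range B, Θ x = x := fun x hx => (hP x).1 (hrangeP hx)
  have hQUmem : ∀ x ∈ U, Θ x = -x → x ∈ Q ⊓ LinearMap.ker B := fun x hxU hΘx => by
    have hxQ : x ∈ Q := (hQ x).2 hΘx
    have h := (hU' x).1 hxU
    rw [hΘ'apply, hΘx, sub_neg_eq_add] at h
    have h' : (2 : ℂ) • D x = 0 := by
      rw [two_smul]
      have := congrArg (fun y => y - x) h
      simpa using this
    have hDx : D x = 0 := (smul_eq_zero.1 h').resolve_left two_ne_zero
    have hBx := (hD6 x hxQ).2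
    rw [hDx, add_zero] at hBx
    exact Submodule.mem_inf.2 ⟨hxQ, LinearMap.mem_ker.2 hBx⟩
  have hQUΘ : ∀ x ∈ Q ⊓ LinearMap.ker B, Θ x = -x := fun x hx => (hQ x).1 (Submodule.mem_inf.1 hx).1
  have hPUQU : ∀ x ∈ LinearMap.range B, ∀ y ∈ Q ⊓ LinearMap.ker B, s x y = 0 := fun x hx y hy =>
    hPQ x (hrangeP hx) y (Submodule.mem_inf.1 hy).1
  have hdefPU : ∀ x ∈ LinearMap.range B, s x x = 0 → x = 0 := fun x hx h => hdefP x (hrangeP hx) h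
  have hdefQU : ∀ y ∈ Q ⊓ LinearMap.ker B, s y y = 0 → y = 0 := fun y hy h =>
    hdefQ y (Submodule.mem_inf.1 hy).1 h
  have hmapC : P.map C = LinearMap.range gC := by
    apply le_antisymm
    · rintro _ ⟨p, hp, rfl⟩
      exact ⟨⟨D p, (hD5 p hp).1⟩, by rw [hgCapply, ← hCD p hp]⟩
    · rintro _ ⟨x, rfl⟩
      exact ⟨x, hrangeP x.2, rfl⟩
  have hfinQU : Module.finrank ℂ ↥(P.map C) = Module.finrank ℂ (LinearMap.range B) := by
    rw [hmapC, LinearMap.finrank_range_of_inj hgCinj]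
  have hfinQ₀ : Module.finrank ℂ ↥(Q ⊓ LinearMap.ker B) + Module.finrank ℂ (LinearMap.range B) =
      Module.finrank ℂ Q := by
    have hsup : (Q ⊓ LinearMap.ker B) ⊔ P.map C = Q := by
      apply le_antisymm (sup_le inf_le_left (by rintro _ ⟨p, hp, rfl⟩; exact hCmem p))
      intro q hq
      obtain ⟨hDq, hBq⟩ := hD6 q hq
      have h : q = (q + D q) + (-(D q)) := by abel
      rw [h]
      refine Submodule.add_mem _ (Submodule.mem_sup_left (Submodule.mem_inf.2 ⟨Submodule.add_mem _ hq ?_,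
        LinearMap.mem_ker.2 hBq⟩)) (Submodule.mem_sup_right (Submodule.neg_mem _ hDq))
      obtain ⟨p, hp, hpq⟩ := hDq
      rw [← hpq]; exact hCmem p
    have hinf : (Q ⊓ LinearMap.ker B) ⊓ P.map C = ⊥ := by
      rw [eq_bot_iff]
      rintro x ⟨⟨-, hxB⟩, ⟨p, hp, rfl⟩⟩
      rw [Submodule.mem_bot]
      exact hpos1 p hp (LinearMap.mem_ker.1 hxB)
    have h := Submodule.finrank_sup_add_finrank_inf_eq (Q ⊓ LinearMap.ker B) (P.map C)
    rw [hsup, hinf, finrank_bot, add_zero, hfinQU] at h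
    exact h.symm
  -- STEP 5: the Levi instance on `U = P₁ ⊕ Q₀`
  have hLevi := UnitaryThreeCoprime.levi_instance hbr hirr hΘΘ hP hQ hadd hsymm hPQ hdefP hdefQ hadj hnΘ'mem hnΘ'sq
    hnΘ's hΘ hΘΘ hn12 hU hPUle hQUle hPUmem hPUΘ hQUmem hQUΘ hPUQU hdefPU hdefQU
    (fun 𝔩 ι P' Q' hbr𝔩 hirr𝔩 hι hιι hP' hQ' hfinP' hfinQ' hP'Q' hdefP' hdefQ' hadj𝔩 =>
      hcore U 𝔩 ι P' Q' hbr𝔩 hirr𝔩 hι hιι hP' hQ' hfinP' (by rw [hfinQ']; exact hfinQ₀) hP'Q' hdefP' hdefQ' hadj𝔩)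
  -- STEP 6: realising a prescribed `T : Q₀ → P₁` as the `Q₀`-restriction of a raising operator
  have hfinQ₀' : Module.finrank ℂ (LinearMap.range B) ≤ Module.finrank ℂ ↥(Q ⊓ LinearMap.ker B) := by omega
  set Q₀ : Submodule ℂ W := Q ⊓ LinearMap.ker B with hQ₀def
  set P₁ : Submodule ℂ W := LinearMap.range B with hP₁def
  set πQ : Module.End ℂ W := (1 + D) * ((2 : ℂ)⁻¹ • (1 - Θ)) with hπQdef
  have hπQapply : ∀ w, πQ w = (2 : ℂ)⁻¹ • (w - Θ w) + D ((2 : ℂ)⁻¹ • (w - Θ w)) := fun w => by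
    rw [hπQdef, Module.End.mul_apply, LinearMap.smul_apply, LinearMap.sub_apply, Module.End.one_apply,
      LinearMap.add_apply, Module.End.one_apply]
  have hπQmem : ∀ w, πQ w ∈ Q₀ := fun w => by
    rw [hπQapply]
    obtain ⟨hDq, hBq⟩ := hD6 _ (hQhat w)
    obtain ⟨p, hp, hpq⟩ := hDq
    refine Submodule.mem_inf.2 ⟨Submodule.add_mem _ (hQhat w) ?_, LinearMap.mem_ker.2 hBq⟩
    rw [← hpq]; exact hCmem p
  have hπQid : ∀ q ∈ Q₀, πQ q = q := fun q hq => by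
    obtain ⟨hqQ, hqB⟩ := Submodule.mem_inf.1 hq
    have h1 : (2 : ℂ)⁻¹ • (q - Θ q) = q := by rw [(hQ q).1 hqQ]; module
    rw [hπQapply, h1, hD4 q hqQ (LinearMap.mem_ker.1 hqB), add_zero]
  set πc : W →ₗ[ℂ] ↥Q₀ := LinearMap.codRestrict Q₀ πQ hπQmem with hπcdef
  have hreal : ∀ T : ↥Q₀ →ₗ[ℂ] ↥P₁, ∃ Bt ∈ 𝔊, Θ * Bt = Bt ∧ Bt * Θ = -Bt ∧
      ∀ q (hq : q ∈ Q₀), Bt q = T ⟨q, hq⟩ := by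
    intro T
    set TW : Module.End ℂ W := P₁.subtype ∘ₗ T ∘ₗ πc with hTWdef
    have hTWapply : ∀ w, TW w = T (πc w) := fun w => rfl
    have hTWmem : ∀ w, TW w ∈ P₁ := fun w => (T (πc w)).2
    have hTWU : ∀ x ∈ U, TW x ∈ U := fun x _ => hPUle (hTWmem x)
    obtain ⟨Z, hZ, hZΘ₁, hZval⟩ := hLevi (TW.restrict hTWU)
    have hZq : ∀ q (hq : q ∈ Q₀), Z q = T ⟨q, hq⟩ := fun q hq => by
      have h := hZval ⟨q, hQUle hq⟩
      rw [LinearMap.restrict_apply] at h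
      change TW q = Z q at h
      rw [← h, hTWapply]
      have hπ : πc q = ⟨q, hq⟩ := Subtype.ext (hπQid q hq)
      rw [hπ]
    set Bt : Module.End ℂ W := (4 : ℂ)⁻¹ • (Z + Θ * Z - Z * Θ - Θ * Z * Θ) with hBtdef
    obtain ⟨hBt, hΘBt, hBtΘ⟩ : Bt ∈ 𝔊 ∧ Θ * Bt = Bt ∧ Bt * Θ = -Bt :=
      UnitaryThetaCore.raise_relations hbr hΘ hΘΘ hZ
    refine ⟨Bt, hBt, hΘBt, hBtΘ, fun q hq => ?_⟩
    have hqΘ : Θ q = -q := hQUΘ q hq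
    have hZqP : Θ (Z q) = Z q := by rw [hZq q hq]; exact (hP _).1 (hrangeP (T ⟨q, hq⟩).2)
    rw [hBtdef, LinearMap.smul_apply, LinearMap.sub_apply, LinearMap.sub_apply, LinearMap.add_apply,
      Module.End.mul_apply, Module.End.mul_apply, Module.End.mul_apply, Module.End.mul_apply, hqΘ, map_neg, map_neg,
      hZqP, ← hZq q hq]
    module
  -- a realised SURJECTIVE `T` has range exactly `P₁`
  have hfull : ∀ T : ↥Q₀ →ₗ[ℂ] ↥P₁, Function.Surjective T → ∀ Bt ∈ 𝔊, Θ * Bt = Bt → Bt * Θ = -Bt →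
      (∀ q (hq : q ∈ Q₀), Bt q = T ⟨q, hq⟩) → ∀ w, Bt w ∈ P₁ := by
    intro T hT Bt hBt hΘBt hBtΘ hBtq w
    have hle : P₁ ≤ LinearMap.range Bt := by
      intro p hp
      obtain ⟨⟨q, hq⟩, hqp⟩ := hT ⟨p, hp⟩
      exact ⟨q, by rw [hBtq q hq, hqp]⟩
    have heq : P₁ = LinearMap.range Bt :=
      Submodule.eq_of_le_of_finrank_le hle (hmax Bt hBt hΘBt hBtΘ)
    rw [heq]
    exact ⟨w, rfl⟩
  -- a surjective `T₀ : Q₀ → P₁` (as `dim Q₀ ≥ dim P₁`)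
  set eP := Module.finBasis ℂ ↥P₁ with hePdef
  set fQ := Module.finBasis ℂ ↥Q₀ with hfQdef
  set T₀ : ↥Q₀ →ₗ[ℂ] ↥P₁ := fQ.constr ℂ (fun i => if h : (i : ℕ) < Module.finrank ℂ ↥P₁ then eP ⟨i, h⟩ else 0)
    with hT₀def
  have hT₀basis : ∀ j : Fin (Module.finrank ℂ ↥P₁),
      T₀ (fQ ⟨j, lt_of_lt_of_le j.2 hfinQ₀'⟩) = eP j := fun j => by
    rw [hT₀def, Module.Basis.constr_basis, dif_pos j.2]
  have hT₀surj : Function.Surjective T₀ := by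
    rw [← LinearMap.range_eq_top, eq_top_iff, ← eP.span_eq, Submodule.span_le]
    rintro _ ⟨j, rfl⟩
    exact ⟨fQ ⟨j, lt_of_lt_of_le j.2 hfinQ₀'⟩, hT₀basis j⟩
  obtain ⟨Bz, hBz, hΘBz, hBzΘ, hBzq⟩ := hreal T₀
  have hBzP₁ : ∀ w, Bz w ∈ P₁ := hfull T₀ hT₀surj Bz hBz hΘBz hBzΘ hBzq
  -- STEP 7: every raising operator maps `Q` (hence `W`) into `P₁`
  have hKP₁ : ∀ B' ∈ 𝔊, Θ * B' = B' → B' * Θ = -B' → (∀ q ∈ Q₀, B' q = 0) →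
      ∀ x ∈ P₁, B' (C x) ∈ P₁ := by
    intro B' hB' hΘB' hB'Θ hkill x hx
    obtain ⟨⟨q, hq⟩, hqx⟩ := hT₀surj ⟨x, hx⟩
    have hBzqx : Bz q = x := by rw [hBzq q hq, hqx]
    obtain ⟨hqQ, hqB⟩ := Submodule.mem_inf.1 hq
    have h := hclub B' hB' hΘB' hB'Θ Bz hBz hΘBz hBzΘ q hqQ (LinearMap.mem_ker.1 hqB)
    rw [hkill q hq, map_zero, map_zero, add_zero, hBzqx] at h
    rw [← h]
    exact (hD5 _ (hraiseval B' hΘB' _)).1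
  have hallQ : ∀ B' ∈ 𝔊, Θ * B' = B' → B' * Θ = -B' → ∀ q ∈ Q, B' q ∈ P₁ := by
    intro B' hB' hΘB' hB'Θ
    -- `T' := B'|_{Q₀}` and a scalar `c` with `T' + c T₀` surjective
    set T'W : Module.End ℂ W := B' ∘ₗ Q₀.subtype ∘ₗ πc with hT'Wdef
    have hT'Wmem : ∀ w, (B'.domRestrict Q₀) (πc w) ∈ P₁ := fun w =>
      hstar' B' hB' hΘB' hB'Θ _ (Submodule.mem_inf.1 (πc w).2).1 (LinearMap.mem_ker.1 (Submodule.mem_inf.1 (πc w).2).2)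
    set T' : ↥Q₀ →ₗ[ℂ] ↥P₁ := LinearMap.codRestrict P₁ (B'.domRestrict Q₀) (fun q =>
      hstar' B' hB' hΘB' hB'Θ _ (Submodule.mem_inf.1 q.2).1 (LinearMap.mem_ker.1 (Submodule.mem_inf.1 q.2).2))
      with hT'def
    have hT'apply : ∀ q : ↥Q₀, (T' q : W) = B' q := fun q => rfl
    obtain ⟨c, hc⟩ := UnitaryRaisingRank.exists_surjective_add_smul T₀ T' hT₀surj
    obtain ⟨B₁, hB₁, hΘB₁, hB₁Θ, hB₁q⟩ := hreal (T' + c • T₀)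
    have hB₁P₁ : ∀ w, B₁ w ∈ P₁ := hfull (T' + c • T₀) hc B₁ hB₁ hΘB₁ hB₁Θ hB₁q
    -- `B' + c Bz − B₁` kills `Q₀`
    set B₃ : Module.End ℂ W := B' + c • Bz - B₁ with hB₃def
    have hB₃mem : B₃ ∈ 𝔊 := Submodule.sub_mem _ (Submodule.add_mem _ hB' (Submodule.smul_mem _ _ hBz)) hB₁
    have hΘB₃ : Θ * B₃ = B₃ := by rw [hB₃def, mul_sub, mul_add, mul_smul_comm, hΘB', hΘBz, hΘB₁]
    have hB₃Θ : B₃ * Θ = -B₃ := by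
      rw [hB₃def, sub_mul, add_mul, smul_mul_assoc, hB'Θ, hBzΘ, hB₁Θ]; module
    have hB₃apply : ∀ w, B₃ w = B' w + c • Bz w - B₁ w := fun w => by
      rw [hB₃def, LinearMap.sub_apply, LinearMap.add_apply, LinearMap.smul_apply]
    have hB₃kill : ∀ q ∈ Q₀, B₃ q = 0 := fun q hq => by
      rw [hB₃apply, hB₁q q hq, hBzq q hq, LinearMap.add_apply, LinearMap.smul_apply, Submodule.coe_add,
        Submodule.coe_smul, hT'apply, sub_eq_zero]
    intro q hq
    -- `q = (q + Dq) + (−Dq)` with `q + Dq ∈ Q₀`, `Dq ∈ C(P)`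
    obtain ⟨hDq, hBq⟩ := hD6 q hq
    obtain ⟨p, hp, hpq⟩ := hDq
    have hq₀ : q + D q ∈ Q₀ := Submodule.mem_inf.2 ⟨Submodule.add_mem _ hq (by rw [← hpq]; exact hCmem p),
      LinearMap.mem_ker.2 hBq⟩
    have hsplitq : q = (q + D q) - D q := by abel
    have hB'Dq : B' (D q) ∈ P₁ := by
      have h3 : B₃ (D q) ∈ P₁ := by
        rw [← hpq, hCD p hp]
        exact hKP₁ B₃ hB₃mem hΘB₃ hB₃Θ hB₃kill _ (hD5 p hp).1
      have h : B' (D q) = B₃ (D q) - c • Bz (D q) + B₁ (D q) := by rw [hB₃apply]; abel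
      rw [h]
      exact Submodule.add_mem _ (Submodule.sub_mem _ h3 (Submodule.smul_mem _ _ (hBzP₁ _))) (hB₁P₁ _)
    rw [hsplitq, map_sub]
    exact Submodule.sub_mem _ (hstar' B' hB' hΘB' hB'Θ _ (Submodule.mem_inf.1 hq₀).1
      (LinearMap.mem_ker.1 (Submodule.mem_inf.1 hq₀).2)) hB'Dq
  have hall : ∀ B' ∈ 𝔊, Θ * B' = B' → B' * Θ = -B' → ∀ w, B' w ∈ P₁ := fun B' hB' hΘB' hB'Θ w => by
    have h : B' w = B' ((2 : ℂ)⁻¹ • (w - Θ w)) := by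
      conv_lhs => rw [← hsplit w, map_add, hraiseP B' hB'Θ _ (hPhat w), zero_add]
    rw [h]
    exact hallQ B' hB' hΘB' hB'Θ _ (hQhat w)
  -- STEP 8: `η ∈ P₀ ∖ 0` is killed by every lowering operator — contradiction with irreducibility
  have hηorth : ∀ x ∈ P₁, s η x = 0 := by
    rintro _ ⟨w, rfl⟩
    rw [hsymm, hBC, hCη, h0r, map_zero]
  have hQ' : ∀ x, x ∈ Q ↔ (-Θ) x = x := fun x => by rw [hQ, LinearMap.neg_apply, neg_eq_iff_eq_neg]
  have hP' : ∀ x, x ∈ P ↔ (-Θ) x = -x := fun x => by rw [hP, LinearMap.neg_apply, neg_inj]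
  have hQP : ∀ q ∈ Q, ∀ p ∈ P, s q p = 0 := fun q hq p hp => by rw [hsymm, hPQ p hp q hq, map_zero]
  have hnΘ : -Θ ∈ 𝔊 := Submodule.neg_mem _ hΘ
  have hnΘΘ : (-Θ) * (-Θ) = 1 := by rw [neg_mul_neg, hΘΘ]
  have hkill : ∀ C' ∈ 𝔊, Θ * C' = -C' → C' * Θ = C' → C' η = 0 := by
    intro C' hC' h1 h2
    obtain ⟨Y, hY, hC'Y⟩ := hadj C' hC'
    have h1' : (-Θ) * C' = C' := by rw [neg_mul, h1, neg_neg]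
    have h2' : C' * (-Θ) = -C' := by rw [mul_neg, h2]
    obtain ⟨hΘY, hYΘ⟩ := UnitaryTwoOdd.lower_of_adjoint hadd hsymm hnΘΘ hQ' hP' hQP hdefQ hdefP h1' h2' hC'Y
    have hΘY' : Θ * Y = Y := by rw [neg_mul, neg_inj] at hΘY; exact hΘY
    have hYΘ' : Y * Θ = -Y := by rw [mul_neg, neg_eq_iff_eq_neg] at hYΘ; exact hYΘ
    have hC'η : C' η ∈ Q := (hQ _).2 (by rw [← Module.End.mul_apply, h1, LinearMap.neg_apply])
    apply hdefQ _ hC'η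
    rw [hC'Y, hηorth _ (hall Y hY hΘY' hYΘ' _)]
  obtain ⟨⟨q₀, hq₀⟩, hq₀0⟩ := Module.finrank_pos_iff_exists_ne_zero.1
    (show 0 < Module.finrank ℂ Q by omega)
  have hq₀0' : (q₀ : W) ≠ 0 := fun h => hq₀0 (Subtype.ext h)
  refine hη0' (UnitaryThetaCore.eq_zero_of_forall_raise_apply_eq_zero hbr hirr hnΘ hnΘΘ
    ⟨q₀, hq₀0', by rw [LinearMap.neg_apply, (hQ _).1 hq₀, neg_neg]⟩
    (by rw [LinearMap.neg_apply, hΘη]) fun C' hC' h1 h2 => hkill C' hC' ?_ ?_)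
  · rw [neg_mul, neg_eq_iff_eq_neg] at h1; exact h1
  · rw [mul_neg, neg_inj] at h2; exact h2

/-! ### §3 The sharp form: `dim Q ≥ r + 2` -/

/-- **The raising-rank lemma, sharp form: `dim Q ≥ r + 2` suffices** (instead of `dim Q ≥ 2r`). Same setting and
conclusion as `exists_raise_rank_gt`. PROOF: as there up to the Levi instance on `U = P₁ ⊕ Q₀`, which realises every
`T : Q₀ → P₁` as the `Q₀`-restriction of a raising `B_T ∈ 𝔊`; then, with a basis `f` of `Q₀` (`dim Q₀ ≥ 2`) and the
rank-one maps `T = f_i^* ⊗ v`: the relation (♣) `B'(C B''q) + B''(C B'q) ∈ P₁` (`q ∈ Q₀`) evaluated at `q = f_j`, `j ≠ i`,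
with `B'' = B_{f_j^* ⊗ x}` shows that every realisation of a rank-one `f_i^* ⊗ v` maps `Q₁ = C(P₁)` into `P₁`, and then,
evaluated at `q = f_i` with `B'' = B_{f_i^* ⊗ w}`, that EVERY raising `B'` maps `Q₁` into `P₁`; so all raising operators
map `Q` into `P₁ ⫋ P`, contradicting irreducibility exactly as before. (No surjective `T₀`, no pencil.) [cite: Ribet1983, Thm. 3] [cite: Deligne1982HodgeCycles, I §3 Prop. 3.6]
[cite: GoodmanWallachGTM255, §4.1.1] -/
theorem UnitaryRaisingRank.exists_raise_rank_gt_of_two_le [FiniteDimensional ℂ W] {𝔊 : Submodule ℂ (Module.End ℂ W)}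
    (hbr : ∀ Y ∈ 𝔊, ∀ Z ∈ 𝔊, Y * Z - Z * Y ∈ 𝔊)
    (hirr : ∀ U : Submodule ℂ W, (∀ A ∈ 𝔊, ∀ u ∈ U, A u ∈ U) → U = ⊥ ∨ U = ⊤)
    {Θ : Module.End ℂ W} (hΘ : Θ ∈ 𝔊) (hΘΘ : Θ * Θ = 1)
    {P Q : Submodule ℂ W} (hP : ∀ x, x ∈ P ↔ Θ x = x) (hQ : ∀ x, x ∈ Q ↔ Θ x = -x)
    {s : W → W → ℂ} (hadd : ∀ x y z, s (x + y) z = s x z + s y z) (hsymm : ∀ x y, s y x = starRingEnd ℂ (s x y))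
    (hPQ : ∀ p ∈ P, ∀ q ∈ Q, s p q = 0) (hdefP : ∀ p ∈ P, s p p = 0 → p = 0) (hdefQ : ∀ q ∈ Q, s q q = 0 → q = 0)
    (hadj : ∀ X ∈ 𝔊, ∃ Y ∈ 𝔊, ∀ x y, s (X x) y = s x (Y y))
    {B : Module.End ℂ W} (hB : B ∈ 𝔊) (hΘB : Θ * B = B) (hBΘ : B * Θ = -B)
    (hr0 : 0 < Module.finrank ℂ (LinearMap.range B))
    (hrP : Module.finrank ℂ (LinearMap.range B) < Module.finrank ℂ P)
    (hrQ : Module.finrank ℂ (LinearMap.range B) + 2 ≤ Module.finrank ℂ Q)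
    (hcore : ∀ (U : Submodule ℂ W) (𝔩 : Submodule ℂ (Module.End ℂ U)) (ι : Module.End ℂ U) (P' Q' : Submodule ℂ U),
      (∀ A ∈ 𝔩, ∀ A' ∈ 𝔩, A * A' - A' * A ∈ 𝔩) →
      (∀ V : Submodule ℂ U, (∀ A ∈ 𝔩, ∀ u ∈ V, A u ∈ V) → V = ⊥ ∨ V = ⊤) →
      ι ∈ 𝔩 → ι * ι = 1 → (∀ x, x ∈ P' ↔ ι x = x) → (∀ x, x ∈ Q' ↔ ι x = -x) →
      Module.finrank ℂ P' = Module.finrank ℂ (LinearMap.range B) →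
      Module.finrank ℂ Q' + Module.finrank ℂ (LinearMap.range B) = Module.finrank ℂ Q →
      (∀ p ∈ P', ∀ q ∈ Q', s (p : W) q = 0) → (∀ p ∈ P', s (p : W) p = 0 → p = 0) →
      (∀ q ∈ Q', s (q : W) q = 0 → q = 0) →
      (∀ A ∈ 𝔩, ∃ A' ∈ 𝔩, ∀ x y : U, s ((A x : U) : W) y = s x ((A' y : U) : W)) → 𝔩 = ⊤) :
    ∃ B' ∈ 𝔊, Θ * B' = B' ∧ B' * Θ = -B' ∧
      Module.finrank ℂ (LinearMap.range B) < Module.finrank ℂ (LinearMap.range B') := by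
  classical
  obtain ⟨haddr, h0r, h0l, hnegr, hnegl, hsubr, hsubl⟩ := UnitaryTwoOdd.herm_right hadd hsymm
  have hΘΘv : ∀ v, Θ (Θ v) = v := fun v => by rw [← Module.End.mul_apply, hΘΘ, Module.End.one_apply]
  have hPhat : ∀ w, (2 : ℂ)⁻¹ • (w + Θ w) ∈ P := fun w => (hP _).2 (by rw [map_smul, map_add, hΘΘv, add_comm])
  have hQhat : ∀ w, (2 : ℂ)⁻¹ • (w - Θ w) ∈ Q := fun w =>
    (hQ _).2 (by rw [map_smul, map_sub, hΘΘv, ← smul_neg, neg_sub])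
  have hsplit : ∀ w, (2 : ℂ)⁻¹ • (w + Θ w) + (2 : ℂ)⁻¹ • (w - Θ w) = w := fun w => by module
  have hraiseval : ∀ Z : Module.End ℂ W, Θ * Z = Z → ∀ w, Z w ∈ P := fun Z hΘZ w =>
    (hP _).2 (by rw [← Module.End.mul_apply, hΘZ])
  have hraiseP : ∀ Z : Module.End ℂ W, Z * Θ = -Z → ∀ p ∈ P, Z p = 0 := fun Z hZΘ p hp => by
    have h : Z p = -(Z p) := by
      conv_lhs => rw [← (hP p).1 hp]
      rw [← Module.End.mul_apply, hZΘ, LinearMap.neg_apply]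
    have h2 : (2 : ℂ) • Z p = 0 := by rw [two_smul]; nth_rewrite 2 [h]; rw [add_neg_cancel]
    exact (smul_eq_zero.1 h2).resolve_left two_ne_zero
  have hΘs := UnitaryTwoOdd.theta_selfAdjoint hadd hsymm hΘΘ hP hQ hPQ
  by_contra hcon
  push Not at hcon
  have hmax : ∀ B' ∈ 𝔊, Θ * B' = B' → B' * Θ = -B' →
      Module.finrank ℂ (LinearMap.range B') ≤ Module.finrank ℂ (LinearMap.range B) := hcon
  -- STEP 1: `B`, its adjoint `C` and the projector pair `D`
  have hBmem : ∀ w, B w ∈ P := hraiseval B hΘB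
  have hBP : ∀ p ∈ P, B p = 0 := hraiseP B hBΘ
  have hrangeP : LinearMap.range B ≤ P := by rintro _ ⟨w, rfl⟩; exact hBmem w
  obtain ⟨C, hC, hBC⟩ := hadj B hB
  obtain ⟨hΘC, hCΘ⟩ := UnitaryTwoOdd.lower_of_adjoint hadd hsymm hΘΘ hP hQ hPQ hdefP hdefQ hΘB hBΘ hBC
  have hCmem : ∀ w, C w ∈ Q := fun w => (hQ _).2 (by rw [← Module.End.mul_apply, hΘC, LinearMap.neg_apply])
  have hCQ : ∀ q ∈ Q, C q = 0 := fun q hq => by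
    have h : C q = -(C q) := by
      conv_lhs => rw [← neg_neg q, ← (hQ q).1 hq, map_neg, ← Module.End.mul_apply, hCΘ]
    have h2 : (2 : ℂ) • C q = 0 := by rw [two_smul]; nth_rewrite 2 [h]; rw [add_neg_cancel]
    exact (smul_eq_zero.1 h2).resolve_left two_ne_zero
  obtain ⟨D, hD, hDΘ, hD1, hD2, hD3, hD4, hD5, hD6, hpos1, hpos2, hdec, hDs⟩ :=
    UnitaryThreeCoprime.exists_projector_pair hbr hΘΘ hP hQ hadd hsymm hPQ hdefP hdefQ hB hC hΘB hBΘ hBC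
  have hDP : ∀ p ∈ P, D p ∈ P := fun p hp => hrangeP (hD5 p hp).1
  have hDfix : ∀ x ∈ LinearMap.range B, D x = x := by rintro _ ⟨w, rfl⟩; exact hD1 w
  have hDDP : ∀ p ∈ P, D (D p) = D p := fun p hp => hDfix _ (hD5 p hp).1
  have hkerD : ∀ p ∈ P, D p = 0 → C p = 0 := fun p hp h => by
    have h' := (hD5 p hp).2; rwa [h, sub_zero] at h'
  have hCinjR : ∀ x ∈ LinearMap.range B, C x = 0 → x = 0 := by rintro _ ⟨w, rfl⟩ h; exact hpos2 w h
  have hCD : ∀ p ∈ P, C p = C (D p) := fun p hp => by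
    have h := (hD5 p hp).2; rw [map_sub, sub_eq_zero] at h; exact h
  -- STEP 2 (★): every raising operator maps `Q₀ = Q ∩ ker B` into `P₁ = B(W)`
  have hcommbr : ∀ X : Module.End ℂ W, Θ * X = X → X * Θ = -X →
      Θ * (D * X - X * D) = D * X - X * D ∧ (D * X - X * D) * Θ = -(D * X - X * D) := fun X h1 h2 =>
    ⟨by rw [mul_sub, ← mul_assoc, ← hDΘ, mul_assoc, h1, ← mul_assoc, h1],
     by rw [sub_mul, mul_assoc, h2, mul_assoc, hDΘ, ← mul_assoc, h2, mul_neg, neg_mul, neg_sub_neg, neg_sub]⟩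
  have hstar : ∀ B' ∈ 𝔊, Θ * B' = B' → B' * Θ = -B' → ∀ q ∈ Q, B q = 0 → D (B' q) = B' q := by
    intro B' hB' hΘB' hB'Θ
    by_contra hne
    push Not at hne
    obtain ⟨q₀, hq₀Q, hBq₀, hneq⟩ := hne
    have hB'P : ∀ p ∈ P, B' p = 0 := hraiseP B' hB'Θ
    have hB'mem : ∀ w, B' w ∈ P := hraiseval B' hΘB'
    set N : Module.End ℂ W := D * B' - B' * D with hNdef
    obtain ⟨hΘN, hNΘ⟩ : Θ * N = N ∧ N * Θ = -N := hcommbr B' hΘB' hB'Θ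
    set N₂ : Module.End ℂ W := D * N - N * D with hN₂def
    obtain ⟨hΘN₂, hN₂Θ⟩ : Θ * N₂ = N₂ ∧ N₂ * Θ = -N₂ := hcommbr N hΘN hNΘ
    have hNmem : N ∈ 𝔊 := hbr D hD B' hB'
    have hN₂mem : N₂ ∈ 𝔊 := hbr D hD N hNmem
    set B₀ : Module.End ℂ W := (2 : ℂ)⁻¹ • (N₂ - (3 : ℂ) • N + (2 : ℂ) • B') with hB₀def
    have hB₀mem : B₀ ∈ 𝔊 := Submodule.smul_mem _ _ (Submodule.add_mem _ (Submodule.sub_mem _ hN₂mem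
      (Submodule.smul_mem _ _ hNmem)) (Submodule.smul_mem _ _ hB'))
    have hΘB₀ : Θ * B₀ = B₀ := by
      rw [hB₀def, mul_smul_comm, mul_add, mul_sub, mul_smul_comm, mul_smul_comm, hΘN₂, hΘN, hΘB']
    have hB₀Θ : B₀ * Θ = -B₀ := by
      rw [hB₀def, smul_mul_assoc, add_mul, sub_mul, smul_mul_assoc, smul_mul_assoc, hN₂Θ, hNΘ, hB'Θ]
      module
    -- values of `N`, `N₂`, `B₀`
    have hNq : ∀ q ∈ Q, B q = 0 → N q = D (B' q) := fun q hq hBq => by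
      rw [hNdef, LinearMap.sub_apply, Module.End.mul_apply, Module.End.mul_apply, hD4 q hq hBq, map_zero, sub_zero]
    have hNP : ∀ p ∈ P, N p = 0 := fun p hp => by
      rw [hNdef, LinearMap.sub_apply, Module.End.mul_apply, Module.End.mul_apply, hB'P p hp, map_zero,
        hB'P _ (hDP p hp), sub_zero]
    have hNC : ∀ p ∈ P, N (C p) = D (B' (C p)) + B' (C p) := fun p hp => by
      rw [hNdef, LinearMap.sub_apply, Module.End.mul_apply, Module.End.mul_apply, hD3 p hp, map_neg, sub_neg_eq_add]
    have hN₂q : ∀ q ∈ Q, B q = 0 → N₂ q = D (B' q) := fun q hq hBq => by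
      rw [hN₂def, LinearMap.sub_apply, Module.End.mul_apply, Module.End.mul_apply, hNq q hq hBq, hD4 q hq hBq,
        map_zero, sub_zero, hDDP _ (hB'mem q)]
    have hN₂C : ∀ p ∈ P, N₂ (C p) = D (B' (C p)) + D (B' (C p)) + (D (B' (C p)) + B' (C p)) := fun p hp => by
      rw [hN₂def, LinearMap.sub_apply, Module.End.mul_apply, Module.End.mul_apply, hNC p hp, hD3 p hp, map_neg,
        hNC p hp, map_add, hDDP _ (hB'mem _), sub_neg_eq_add]
    have hB₀q : ∀ q ∈ Q, B q = 0 → B₀ q = B' q - D (B' q) := fun q hq hBq => by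
      rw [hB₀def, LinearMap.smul_apply, LinearMap.add_apply, LinearMap.sub_apply, LinearMap.smul_apply,
        LinearMap.smul_apply, hN₂q q hq hBq, hNq q hq hBq]
      module
    have hB₀C : ∀ p ∈ P, B₀ (C p) = 0 := fun p hp => by
      rw [hB₀def, LinearMap.smul_apply, LinearMap.add_apply, LinearMap.sub_apply, LinearMap.smul_apply,
        LinearMap.smul_apply, hN₂C p hp, hNC p hp]
      module
    -- `B + B₀` is raising and maps onto `P`
    have hsum_mem : B + B₀ ∈ 𝔊 := Submodule.add_mem _ hB hB₀mem
    have hΘsum : Θ * (B + B₀) = B + B₀ := by rw [mul_add, hΘB, hΘB₀]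
    have hsumΘ : (B + B₀) * Θ = -(B + B₀) := by rw [add_mul, hBΘ, hB₀Θ, neg_add]
    set x₀ := B' q₀ - D (B' q₀) with hx₀def
    have hx₀P : x₀ ∈ P := Submodule.sub_mem _ (hB'mem q₀) (hDP _ (hB'mem q₀))
    have hx₀0 : x₀ ≠ 0 := fun h => hneq (by rw [hx₀def, sub_eq_zero] at h; exact h.symm)
    have hx₀nr : x₀ ∉ LinearMap.range B := fun h => by
      have h1 := hDfix x₀ h
      rw [hx₀def, map_sub, hDDP _ (hB'mem q₀), sub_self] at h1
      exact hx₀0 h1.symm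
    have hx₀val : (B + B₀) q₀ = x₀ := by
      rw [LinearMap.add_apply, hBq₀, zero_add, hB₀q q₀ hq₀Q hBq₀]
    have hrange1 : LinearMap.range B ≤ LinearMap.range (B + B₀) := by
      rintro _ ⟨w, rfl⟩
      set q := (2 : ℂ)⁻¹ • (w - Θ w) with hqdef
      obtain ⟨hDq, hBq⟩ := hD6 q (hQhat w)
      obtain ⟨p', hp', hp'q⟩ := hDq
      refine ⟨-(D q), ?_⟩
      have hBw : B w = B q := by
        conv_lhs => rw [← hsplit w, map_add, hBP _ (hPhat w), zero_add]
      rw [LinearMap.add_apply, map_neg, map_neg, ← hp'q, hB₀C p' hp', neg_zero, add_zero, hp'q, hBw]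
      rw [map_add] at hBq
      rw [← neg_eq_of_add_eq_zero_right hBq, neg_neg]
    have hrange2 : LinearMap.range B ⊔ (ℂ ∙ x₀) ≤ LinearMap.range (B + B₀) :=
      sup_le hrange1 ((Submodule.span_singleton_le_iff_mem _ _).2 ⟨q₀, hx₀val⟩)
    have hinf : LinearMap.range B ⊓ (ℂ ∙ x₀) = ⊥ := by
      rw [eq_bot_iff]
      rintro y ⟨hy1, hy2⟩
      rw [Submodule.mem_bot]
      obtain ⟨c, rfl⟩ := Submodule.mem_span_singleton.1 hy2
      by_cases hc : c = 0
      · rw [hc, zero_smul]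
      · exact absurd (by
          have := Submodule.smul_mem _ c⁻¹ hy1
          rwa [smul_smul, inv_mul_cancel₀ hc, one_smul] at this) hx₀nr
    have hfin : Module.finrank ℂ ↥(LinearMap.range B ⊔ (ℂ ∙ x₀)) = Module.finrank ℂ (LinearMap.range B) + 1 := by
      have h := Submodule.finrank_sup_add_finrank_inf_eq (LinearMap.range B) (ℂ ∙ x₀)
      rw [hinf, finrank_bot, add_zero, finrank_span_singleton hx₀0] at h
      exact h
    have hmono := Submodule.finrank_mono hrange2
    have hle' := hmax (B + B₀) hsum_mem hΘsum hsumΘ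
    rw [hfin] at hmono
    omega
  have hstar' : ∀ B' ∈ 𝔊, Θ * B' = B' → B' * Θ = -B' → ∀ q ∈ Q, B q = 0 → B' q ∈ LinearMap.range B :=
    fun B' hB' h1 h2 q hq hBq => hstar B' hB' h1 h2 q hq hBq ▸ (hD5 _ (hraiseval B' h1 q)).1
  -- STEP 3 (♣)
  have hclub : ∀ B' ∈ 𝔊, Θ * B' = B' → B' * Θ = -B' → ∀ B'' ∈ 𝔊, Θ * B'' = B'' → B'' * Θ = -B'' →
      ∀ q ∈ Q, B q = 0 → D (B' (C (B'' q)) + B'' (C (B' q))) = B' (C (B'' q)) + B'' (C (B' q)) := by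
    intro B' hB' hΘB' hB'Θ B'' hB'' hΘB'' hB''Θ q hq hBq
    set M : Module.End ℂ W := B' * C - C * B' with hMdef
    have hMmem : M ∈ 𝔊 := hbr B' hB' C hC
    have hMΘ : M * Θ = Θ * M := by
      rw [hMdef, sub_mul, mul_sub, mul_assoc, hCΘ, mul_assoc, hB'Θ, ← mul_assoc, hΘB', ← mul_assoc, hΘC, mul_neg,
        neg_mul]
    set R : Module.End ℂ W := M * B'' - B'' * M with hRdef
    have hRmem : R ∈ 𝔊 := hbr M hMmem B'' hB''
    have hΘR : Θ * R = R := by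
      rw [hRdef, mul_sub, ← mul_assoc, ← hMΘ, mul_assoc, hΘB'', ← mul_assoc, hΘB'']
    have hRΘ : R * Θ = -R := by
      rw [hRdef, sub_mul, mul_assoc, hB''Θ, mul_assoc, hMΘ, ← mul_assoc, hB''Θ, mul_neg, neg_mul, neg_sub_neg, neg_sub]
    have h := hstar R hRmem hΘR hRΘ q hq hBq
    have hRq : R q = B' (C (B'' q)) + B'' (C (B' q)) := by
      rw [hRdef, LinearMap.sub_apply, Module.End.mul_apply, Module.End.mul_apply, hMdef, LinearMap.sub_apply,
        LinearMap.sub_apply, Module.End.mul_apply, Module.End.mul_apply, Module.End.mul_apply, Module.End.mul_apply,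
        hraiseP B' hB'Θ _ (hraiseval B'' hΘB'' q), map_zero, sub_zero, hCQ q hq, map_zero, zero_sub, map_neg,
        sub_neg_eq_add]
    rwa [hRq] at h
  -- STEP 4: dimensions of the pieces `P₀ = P ∩ ker C`, `Q₁ = C(P)`, `Q₀ = Q ∩ ker B`
  have hfinP₀ : Module.finrank ℂ ↥(P ⊓ LinearMap.ker C) + Module.finrank ℂ (LinearMap.range B) =
      Module.finrank ℂ P := by
    have hsup : (P ⊓ LinearMap.ker C) ⊔ LinearMap.range B = P := by
      apply le_antisymm (sup_le inf_le_left hrangeP)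
      intro p hp
      obtain ⟨hDp, hCp⟩ := hD5 p hp
      have h : p = (p - D p) + D p := by abel
      rw [h]
      exact Submodule.add_mem _ (Submodule.mem_sup_left (Submodule.mem_inf.2
        ⟨Submodule.sub_mem _ hp (hrangeP hDp), LinearMap.mem_ker.2 hCp⟩)) (Submodule.mem_sup_right hDp)
    have hinf : (P ⊓ LinearMap.ker C) ⊓ LinearMap.range B = ⊥ := by
      rw [eq_bot_iff]
      rintro x ⟨⟨-, hxC⟩, hxr⟩
      rw [Submodule.mem_bot]
      exact hCinjR x hxr (LinearMap.mem_ker.1 hxC)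
    have h := Submodule.finrank_sup_add_finrank_inf_eq (P ⊓ LinearMap.ker C) (LinearMap.range B)
    rw [hsup, hinf, finrank_bot, add_zero] at h
    exact h.symm
  obtain ⟨⟨η, hηmem⟩, hη0⟩ := Module.finrank_pos_iff_exists_ne_zero.1
    (show 0 < Module.finrank ℂ ↥(P ⊓ LinearMap.ker C) by omega)
  have hη0' : η ≠ 0 := fun h => hη0 (Subtype.ext h)
  obtain ⟨hηP, hηC⟩ := Submodule.mem_inf.1 hηmem
  have hCη : C η = 0 := LinearMap.mem_ker.1 hηC
  have hΘη : Θ η = η := (hP η).1 hηP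
  set gC : ↥(LinearMap.range B) →ₗ[ℂ] W := C ∘ₗ (LinearMap.range B).subtype with hgCdef
  have hgCapply : ∀ x : LinearMap.range B, gC x = C x := fun x => rfl
  have hgCinj : Function.Injective gC := by
    intro x y hxy
    apply Subtype.ext
    have h : C ((x : W) - y) = 0 := by rw [map_sub, sub_eq_zero]; exact hxy
    exact sub_eq_zero.1 (hCinjR _ (Submodule.sub_mem _ x.2 y.2) h)
  -- STEP 5: the involution `Θ' = 2D − Θ` and its Levi instance on `{Θ' = −1} = P₀ ⊕ Q₁`
  set Θ' : Module.End ℂ W := (2 : ℂ) • D - Θ with hΘ'def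
  have hΘ'mem : Θ' ∈ 𝔊 := Submodule.sub_mem _ (Submodule.smul_mem _ _ hD) hΘ
  have hΘ'apply : ∀ w, Θ' w = D w + D w - Θ w := fun w => by
    rw [hΘ'def, LinearMap.sub_apply, LinearMap.smul_apply, two_smul]
  have hΘ'a : ∀ a ∈ LinearMap.range B, Θ' a = a := fun a ha => by
    rw [hΘ'apply, hDfix a ha, (hP a).1 (hrangeP ha)]; abel
  have hΘ'b : ∀ b ∈ P ⊓ LinearMap.ker C, Θ' b = -b := fun b hb => by
    obtain ⟨hbP, hbC⟩ := Submodule.mem_inf.1 hb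
    rw [hΘ'apply, hD2 b hbP (LinearMap.mem_ker.1 hbC), (hP b).1 hbP]; abel
  have hΘ'c : ∀ c ∈ P.map C, Θ' c = -c := fun c hc => by
    obtain ⟨p, hp, rfl⟩ := hc
    rw [hΘ'apply, hD3 p hp, (hQ _).1 (hCmem p)]; abel
  have hΘ'd : ∀ d ∈ Q ⊓ LinearMap.ker B, Θ' d = d := fun d hd => by
    obtain ⟨hdQ, hdB⟩ := Submodule.mem_inf.1 hd
    rw [hΘ'apply, hD4 d hdQ (LinearMap.mem_ker.1 hdB), (hQ d).1 hdQ]; abel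
  have hΘ'Θ' : Θ' * Θ' = 1 := by
    refine LinearMap.ext fun w => ?_
    obtain ⟨a, ha, b, hb, c, hc, d, hd, rfl⟩ := hdec w
    have h1 : Θ' (a + b + c + d) = a - b - c + d := by
      rw [map_add, map_add, map_add, hΘ'a a ha, hΘ'b b hb, hΘ'c c hc, hΘ'd d hd]; abel
    have h2 : Θ' (a - b - c + d) = a + b + c + d := by
      rw [map_add, map_sub, map_sub, hΘ'a a ha, hΘ'b b hb, hΘ'c c hc, hΘ'd d hd]; abel
    rw [Module.End.mul_apply, Module.End.one_apply, h1, h2]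
  have h12 : Θ' * Θ = Θ * Θ' := by
    rw [hΘ'def, sub_mul, mul_sub, smul_mul_assoc, mul_smul_comm, hDΘ]
  have hΘ's : ∀ x y, s (Θ' x) y = s x (Θ' y) := fun x y => by
    rw [hΘ'apply, hΘ'apply, hsubl, hadd, hsubr, haddr, hDs, hΘs]
  -- the involution `Θ₁ := −Θ' = Θ − 2D` and `U := {Θ₁ = −1} = P₁ ⊕ Q₀`
  have hnΘ'mem : -Θ' ∈ 𝔊 := Submodule.neg_mem _ hΘ'mem
  have hnΘ'sq : (-Θ') * (-Θ') = 1 := by rw [neg_mul_neg, hΘ'Θ']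
  have hnΘ's : ∀ x y, s ((-Θ') x) y = s x ((-Θ') y) := fun x y => by
    rw [LinearMap.neg_apply, LinearMap.neg_apply, hnegl, hnegr, hΘ's]
  have hn12 : (-Θ') * Θ = Θ * (-Θ') := by rw [neg_mul, mul_neg, h12]
  set U : Submodule ℂ W := LinearMap.ker (Θ' - 1) with hUdef
  have hU' : ∀ x, x ∈ U ↔ Θ' x = x := fun x => by
    rw [hUdef, LinearMap.mem_ker, LinearMap.sub_apply, Module.End.one_apply, sub_eq_zero]
  have hU : ∀ x, x ∈ U ↔ (-Θ') x = -x := fun x => by rw [hU', LinearMap.neg_apply, neg_inj]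
  have hPUle : LinearMap.range B ≤ U := fun a ha => (hU' a).2 (hΘ'a a ha)
  have hQUle : Q ⊓ LinearMap.ker B ≤ U := fun d hd => (hU' d).2 (hΘ'd d hd)
  have hPUmem : ∀ x ∈ U, Θ x = x → x ∈ LinearMap.range B := fun x hxU hΘx => by
    have hxP : x ∈ P := (hP x).2 hΘx
    have h := (hU' x).1 hxU
    rw [hΘ'apply, hΘx, sub_eq_iff_eq_add, ← two_smul ℂ, ← two_smul ℂ] at h
    have hDx : D x = x := smul_right_injective W (two_ne_zero' ℂ) h
    rw [← hDx]
    exact (hD5 x hxP).1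
  have hPUΘ : ∀ x ∈ LinearMap.range B, Θ x = x := fun x hx => (hP x).1 (hrangeP hx)
  have hQUmem : ∀ x ∈ U, Θ x = -x → x ∈ Q ⊓ LinearMap.ker B := fun x hxU hΘx => by
    have hxQ : x ∈ Q := (hQ x).2 hΘx
    have h := (hU' x).1 hxU
    rw [hΘ'apply, hΘx, sub_neg_eq_add] at h
    have h' : (2 : ℂ) • D x = 0 := by
      rw [two_smul]
      have := congrArg (fun y => y - x) h
      simpa using this
    have hDx : D x = 0 := (smul_eq_zero.1 h').resolve_left two_ne_zero
    have hBx := (hD6 x hxQ).2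
    rw [hDx, add_zero] at hBx
    exact Submodule.mem_inf.2 ⟨hxQ, LinearMap.mem_ker.2 hBx⟩
  have hQUΘ : ∀ x ∈ Q ⊓ LinearMap.ker B, Θ x = -x := fun x hx => (hQ x).1 (Submodule.mem_inf.1 hx).1
  have hPUQU : ∀ x ∈ LinearMap.range B, ∀ y ∈ Q ⊓ LinearMap.ker B, s x y = 0 := fun x hx y hy =>
    hPQ x (hrangeP hx) y (Submodule.mem_inf.1 hy).1
  have hdefPU : ∀ x ∈ LinearMap.range B, s x x = 0 → x = 0 := fun x hx h => hdefP x (hrangeP hx) h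
  have hdefQU : ∀ y ∈ Q ⊓ LinearMap.ker B, s y y = 0 → y = 0 := fun y hy h =>
    hdefQ y (Submodule.mem_inf.1 hy).1 h
  have hmapC : P.map C = LinearMap.range gC := by
    apply le_antisymm
    · rintro _ ⟨p, hp, rfl⟩
      exact ⟨⟨D p, (hD5 p hp).1⟩, by rw [hgCapply, ← hCD p hp]⟩
    · rintro _ ⟨x, rfl⟩
      exact ⟨x, hrangeP x.2, rfl⟩
  have hfinQU : Module.finrank ℂ ↥(P.map C) = Module.finrank ℂ (LinearMap.range B) := by
    rw [hmapC, LinearMap.finrank_range_of_inj hgCinj]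
  have hfinQ₀ : Module.finrank ℂ ↥(Q ⊓ LinearMap.ker B) + Module.finrank ℂ (LinearMap.range B) =
      Module.finrank ℂ Q := by
    have hsup : (Q ⊓ LinearMap.ker B) ⊔ P.map C = Q := by
      apply le_antisymm (sup_le inf_le_left (by rintro _ ⟨p, hp, rfl⟩; exact hCmem p))
      intro q hq
      obtain ⟨hDq, hBq⟩ := hD6 q hq
      have h : q = (q + D q) + (-(D q)) := by abel
      rw [h]
      refine Submodule.add_mem _ (Submodule.mem_sup_left (Submodule.mem_inf.2 ⟨Submodule.add_mem _ hq ?_,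
        LinearMap.mem_ker.2 hBq⟩)) (Submodule.mem_sup_right (Submodule.neg_mem _ hDq))
      obtain ⟨p, hp, hpq⟩ := hDq
      rw [← hpq]; exact hCmem p
    have hinf : (Q ⊓ LinearMap.ker B) ⊓ P.map C = ⊥ := by
      rw [eq_bot_iff]
      rintro x ⟨⟨-, hxB⟩, ⟨p, hp, rfl⟩⟩
      rw [Submodule.mem_bot]
      exact hpos1 p hp (LinearMap.mem_ker.1 hxB)
    have h := Submodule.finrank_sup_add_finrank_inf_eq (Q ⊓ LinearMap.ker B) (P.map C)
    rw [hsup, hinf, finrank_bot, add_zero, hfinQU] at h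
    exact h.symm
  -- STEP 5: the Levi instance on `U = P₁ ⊕ Q₀`
  have hLevi := UnitaryThreeCoprime.levi_instance hbr hirr hΘΘ hP hQ hadd hsymm hPQ hdefP hdefQ hadj hnΘ'mem hnΘ'sq
    hnΘ's hΘ hΘΘ hn12 hU hPUle hQUle hPUmem hPUΘ hQUmem hQUΘ hPUQU hdefPU hdefQU
    (fun 𝔩 ι P' Q' hbr𝔩 hirr𝔩 hι hιι hP' hQ' hfinP' hfinQ' hP'Q' hdefP' hdefQ' hadj𝔩 =>
      hcore U 𝔩 ι P' Q' hbr𝔩 hirr𝔩 hι hιι hP' hQ' hfinP' (by rw [hfinQ']; exact hfinQ₀) hP'Q' hdefP' hdefQ' hadj𝔩)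
  -- STEP 6: realising a prescribed `T : Q₀ → P₁` as the `Q₀`-restriction of a raising operator
  have hfinQ₀' : 2 ≤ Module.finrank ℂ ↥(Q ⊓ LinearMap.ker B) := by omega
  set Q₀ : Submodule ℂ W := Q ⊓ LinearMap.ker B with hQ₀def
  set P₁ : Submodule ℂ W := LinearMap.range B with hP₁def
  set πQ : Module.End ℂ W := (1 + D) * ((2 : ℂ)⁻¹ • (1 - Θ)) with hπQdef
  have hπQapply : ∀ w, πQ w = (2 : ℂ)⁻¹ • (w - Θ w) + D ((2 : ℂ)⁻¹ • (w - Θ w)) := fun w => by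
    rw [hπQdef, Module.End.mul_apply, LinearMap.smul_apply, LinearMap.sub_apply, Module.End.one_apply,
      LinearMap.add_apply, Module.End.one_apply]
  have hπQmem : ∀ w, πQ w ∈ Q₀ := fun w => by
    rw [hπQapply]
    obtain ⟨hDq, hBq⟩ := hD6 _ (hQhat w)
    obtain ⟨p, hp, hpq⟩ := hDq
    refine Submodule.mem_inf.2 ⟨Submodule.add_mem _ (hQhat w) ?_, LinearMap.mem_ker.2 hBq⟩
    rw [← hpq]; exact hCmem p
  have hπQid : ∀ q ∈ Q₀, πQ q = q := fun q hq => by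
    obtain ⟨hqQ, hqB⟩ := Submodule.mem_inf.1 hq
    have h1 : (2 : ℂ)⁻¹ • (q - Θ q) = q := by rw [(hQ q).1 hqQ]; module
    rw [hπQapply, h1, hD4 q hqQ (LinearMap.mem_ker.1 hqB), add_zero]
  set πc : W →ₗ[ℂ] ↥Q₀ := LinearMap.codRestrict Q₀ πQ hπQmem with hπcdef
  have hreal : ∀ T : ↥Q₀ →ₗ[ℂ] ↥P₁, ∃ Bt ∈ 𝔊, Θ * Bt = Bt ∧ Bt * Θ = -Bt ∧
      ∀ q (hq : q ∈ Q₀), Bt q = T ⟨q, hq⟩ := by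
    intro T
    set TW : Module.End ℂ W := P₁.subtype ∘ₗ T ∘ₗ πc with hTWdef
    have hTWapply : ∀ w, TW w = T (πc w) := fun w => rfl
    have hTWmem : ∀ w, TW w ∈ P₁ := fun w => (T (πc w)).2
    have hTWU : ∀ x ∈ U, TW x ∈ U := fun x _ => hPUle (hTWmem x)
    obtain ⟨Z, hZ, hZΘ₁, hZval⟩ := hLevi (TW.restrict hTWU)
    have hZq : ∀ q (hq : q ∈ Q₀), Z q = T ⟨q, hq⟩ := fun q hq => by
      have h := hZval ⟨q, hQUle hq⟩
      rw [LinearMap.restrict_apply] at h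
      change TW q = Z q at h
      rw [← h, hTWapply]
      have hπ : πc q = ⟨q, hq⟩ := Subtype.ext (hπQid q hq)
      rw [hπ]
    set Bt : Module.End ℂ W := (4 : ℂ)⁻¹ • (Z + Θ * Z - Z * Θ - Θ * Z * Θ) with hBtdef
    obtain ⟨hBt, hΘBt, hBtΘ⟩ : Bt ∈ 𝔊 ∧ Θ * Bt = Bt ∧ Bt * Θ = -Bt :=
      UnitaryThetaCore.raise_relations hbr hΘ hΘΘ hZ
    refine ⟨Bt, hBt, hΘBt, hBtΘ, fun q hq => ?_⟩
    have hqΘ : Θ q = -q := hQUΘ q hq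
    have hZqP : Θ (Z q) = Z q := by rw [hZq q hq]; exact (hP _).1 (hrangeP (T ⟨q, hq⟩).2)
    rw [hBtdef, LinearMap.smul_apply, LinearMap.sub_apply, LinearMap.sub_apply, LinearMap.add_apply,
      Module.End.mul_apply, Module.End.mul_apply, Module.End.mul_apply, Module.End.mul_apply, hqΘ, map_neg, map_neg,
      hZqP, ← hZq q hq]
    module
  -- STEP 7: a basis `f` of `Q₀` (`dim Q₀ ≥ 2`) and rank-one realisations
  set fQ := Module.finBasis ℂ ↥Q₀ with hfQdef
  have hm2 : 2 ≤ Module.finrank ℂ ↥Q₀ := hfinQ₀'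
  set i₀ : Fin (Module.finrank ℂ ↥Q₀) := ⟨0, by omega⟩ with hi₀def
  set i₁ : Fin (Module.finrank ℂ ↥Q₀) := ⟨1, by omega⟩ with hi₁def
  have h01 : i₀ ≠ i₁ := fun h => by
    have := congrArg Fin.val h
    rw [hi₀def, hi₁def] at this
    exact absurd this (by norm_num)
  have hcoord_self : ∀ i, fQ.coord i (fQ i) = 1 := fun i => by
    rw [Module.Basis.coord_apply, fQ.repr_self, Finsupp.single_eq_same]
  have hcoord_ne : ∀ i j, i ≠ j → fQ.coord i (fQ j) = 0 := fun i j hij => by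
    rw [Module.Basis.coord_apply, fQ.repr_self, Finsupp.single_eq_of_ne hij]
  -- (♣) in `P₁`-membership form
  have hclubmem : ∀ B' ∈ 𝔊, Θ * B' = B' → B' * Θ = -B' → ∀ B'' ∈ 𝔊, Θ * B'' = B'' → B'' * Θ = -B'' →
      ∀ q ∈ Q₀, B' (C (B'' q)) + B'' (C (B' q)) ∈ P₁ := by
    intro B' hB' hΘB' hB'Θ B'' hB'' hΘB'' hB''Θ q hq
    obtain ⟨hqQ, hqB⟩ := Submodule.mem_inf.1 hq
    have h := hclub B' hB' hΘB' hB'Θ B'' hB'' hΘB'' hB''Θ q hqQ (LinearMap.mem_ker.1 hqB)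
    rw [← h]
    exact (hD5 _ (Submodule.add_mem _ (hraiseval B' hΘB' _) (hraiseval B'' hΘB'' _))).1
  -- every realisation of a rank-one `f_i^* ⊗ v` maps `Q₁ = C(P₁)` into `P₁`
  have hrank1 : ∀ (i j : Fin (Module.finrank ℂ ↥Q₀)), i ≠ j → ∀ (v : ↥P₁) (Bt : Module.End ℂ W), Bt ∈ 𝔊 →
      Θ * Bt = Bt → Bt * Θ = -Bt → (∀ q (hq : q ∈ Q₀), Bt q = ((fQ.coord i).smulRight v) ⟨q, hq⟩) →
      ∀ x ∈ P₁, Bt (C x) ∈ P₁ := by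
    intro i j hij v Bt hBt hΘBt hBtΘ hBtq x hx
    obtain ⟨Bx, hBx, hΘBx, hBxΘ, hBxq⟩ := hreal ((fQ.coord j).smulRight ⟨x, hx⟩)
    have hq' := (fQ j).2
    have h := hclubmem Bt hBt hΘBt hBtΘ Bx hBx hΘBx hBxΘ (fQ j) hq'
    have hBxval : Bx (fQ j : W) = x := by
      rw [hBxq _ hq', Subtype.coe_eta, LinearMap.smulRight_apply, hcoord_self, one_smul]
    have hBtval : Bt (fQ j : W) = 0 := by
      rw [hBtq _ hq', Subtype.coe_eta, LinearMap.smulRight_apply, hcoord_ne i j hij, zero_smul, Submodule.coe_zero]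
    rwa [hBxval, hBtval, map_zero, map_zero, add_zero] at h
  -- hence EVERY raising operator maps `Q₁` into `P₁`
  have hQ₁P₁ : ∀ B' ∈ 𝔊, Θ * B' = B' → B' * Θ = -B' → ∀ x ∈ P₁, B' (C x) ∈ P₁ := by
    intro B' hB' hΘB' hB'Θ x hx
    obtain ⟨Bx, hBx, hΘBx, hBxΘ, hBxq⟩ := hreal ((fQ.coord i₀).smulRight ⟨x, hx⟩)
    have hq' := (fQ i₀).2
    have h := hclubmem B' hB' hΘB' hB'Θ Bx hBx hΘBx hBxΘ (fQ i₀) hq'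
    have hBxval : Bx (fQ i₀ : W) = x := by
      rw [hBxq _ hq', Subtype.coe_eta, LinearMap.smulRight_apply, hcoord_self, one_smul]
    have hB'q : B' (fQ i₀ : W) ∈ P₁ :=
      hstar' B' hB' hΘB' hB'Θ _ (Submodule.mem_inf.1 hq').1 (LinearMap.mem_ker.1 (Submodule.mem_inf.1 hq').2)
    have h2 : Bx (C (B' (fQ i₀ : W))) ∈ P₁ :=
      hrank1 i₀ i₁ h01 ⟨x, hx⟩ Bx hBx hΘBx hBxΘ hBxq _ hB'q
    rw [hBxval] at h
    have h3 : B' (C x) = (B' (C x) + Bx (C (B' (fQ i₀ : W)))) - Bx (C (B' (fQ i₀ : W))) := by abel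
    rw [h3]
    exact Submodule.sub_mem _ h h2
  have hallQ : ∀ B' ∈ 𝔊, Θ * B' = B' → B' * Θ = -B' → ∀ q ∈ Q, B' q ∈ P₁ := by
    intro B' hB' hΘB' hB'Θ q hq
    obtain ⟨hDq, hBq⟩ := hD6 q hq
    obtain ⟨p, hp, hpq⟩ := hDq
    have hq₀ : q + D q ∈ Q₀ := Submodule.mem_inf.2 ⟨Submodule.add_mem _ hq (by rw [← hpq]; exact hCmem p),
      LinearMap.mem_ker.2 hBq⟩
    have hsplitq : q = (q + D q) - D q := by abel
    have hB'Dq : B' (D q) ∈ P₁ := by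
      rw [← hpq, hCD p hp]
      exact hQ₁P₁ B' hB' hΘB' hB'Θ _ (hD5 p hp).1
    rw [hsplitq, map_sub]
    exact Submodule.sub_mem _ (hstar' B' hB' hΘB' hB'Θ _ (Submodule.mem_inf.1 hq₀).1
      (LinearMap.mem_ker.1 (Submodule.mem_inf.1 hq₀).2)) hB'Dq
  have hall : ∀ B' ∈ 𝔊, Θ * B' = B' → B' * Θ = -B' → ∀ w, B' w ∈ P₁ := fun B' hB' hΘB' hB'Θ w => by
    have h : B' w = B' ((2 : ℂ)⁻¹ • (w - Θ w)) := by
      conv_lhs => rw [← hsplit w, map_add, hraiseP B' hB'Θ _ (hPhat w), zero_add]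
    rw [h]
    exact hallQ B' hB' hΘB' hB'Θ _ (hQhat w)
  -- STEP 8: `η ∈ P₀ ∖ 0` is killed by every lowering operator — contradiction with irreducibility
  have hηorth : ∀ x ∈ P₁, s η x = 0 := by
    rintro _ ⟨w, rfl⟩
    rw [hsymm, hBC, hCη, h0r, map_zero]
  have hQ' : ∀ x, x ∈ Q ↔ (-Θ) x = x := fun x => by rw [hQ, LinearMap.neg_apply, neg_eq_iff_eq_neg]
  have hP' : ∀ x, x ∈ P ↔ (-Θ) x = -x := fun x => by rw [hP, LinearMap.neg_apply, neg_inj]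
  have hQP : ∀ q ∈ Q, ∀ p ∈ P, s q p = 0 := fun q hq p hp => by rw [hsymm, hPQ p hp q hq, map_zero]
  have hnΘ : -Θ ∈ 𝔊 := Submodule.neg_mem _ hΘ
  have hnΘΘ : (-Θ) * (-Θ) = 1 := by rw [neg_mul_neg, hΘΘ]
  have hkill : ∀ C' ∈ 𝔊, Θ * C' = -C' → C' * Θ = C' → C' η = 0 := by
    intro C' hC' h1 h2
    obtain ⟨Y, hY, hC'Y⟩ := hadj C' hC'
    have h1' : (-Θ) * C' = C' := by rw [neg_mul, h1, neg_neg]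
    have h2' : C' * (-Θ) = -C' := by rw [mul_neg, h2]
    obtain ⟨hΘY, hYΘ⟩ := UnitaryTwoOdd.lower_of_adjoint hadd hsymm hnΘΘ hQ' hP' hQP hdefQ hdefP h1' h2' hC'Y
    have hΘY' : Θ * Y = Y := by rw [neg_mul, neg_inj] at hΘY; exact hΘY
    have hYΘ' : Y * Θ = -Y := by rw [mul_neg, neg_eq_iff_eq_neg] at hYΘ; exact hYΘ
    have hC'η : C' η ∈ Q := (hQ _).2 (by rw [← Module.End.mul_apply, h1, LinearMap.neg_apply])
    apply hdefQ _ hC'η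
    rw [hC'Y, hηorth _ (hall Y hY hΘY' hYΘ' _)]
  obtain ⟨⟨q₀, hq₀⟩, hq₀0⟩ := Module.finrank_pos_iff_exists_ne_zero.1
    (show 0 < Module.finrank ℂ Q by omega)
  have hq₀0' : (q₀ : W) ≠ 0 := fun h => hq₀0 (Subtype.ext h)
  refine hη0' (UnitaryThetaCore.eq_zero_of_forall_raise_apply_eq_zero hbr hirr hnΘ hnΘΘ
    ⟨q₀, hq₀0', by rw [LinearMap.neg_apply, (hQ _).1 hq₀, neg_neg]⟩
    (by rw [LinearMap.neg_apply, hΘη]) fun C' hC' h1 h2 => hkill C' hC' ?_ ?_)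
  · rw [neg_mul, neg_eq_iff_eq_neg] at h1; exact h1
  · rw [mul_neg, neg_inj] at h2; exact h2

end HodgeStructure

end Literature.AlgebraicGeometry.Motives

end
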